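import Mathlib
import HarnessLib
import HarnessLib.Audit
import Summits.FinalStateConjecture.Statement
import Literature.Geometry.Lorentzian.TrappedSurface
import Literature.Geometry.Lorentzian.EventHorizon
import Literature.Geometry.Lorentzian.CutBondiMass
import HarnessLib.Audit.Status.Attr

/-!
Route: RootDecompFinalChargeCells

# Route RootDecompFinalChargeCells — Root decomposition N2e «FinalChargeCells» (form b″) —
HoleCountCells leaves by signature; the single-hole residual 27603 cut by the FINAL BONDI MASS and
FINAL HORIZON AREA of its own MGHD

DECOMPOSITION CELL decomp-fsc (D-0178; doctrine D-0170/0171/0172), summit S =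
`_root_.FinalStateConjecture` exactly as typed; LADDER rung 0 — NOTHING IN THIS FILE PROVES THE
FINAL STATE CONJECTURE. THIN SIBLING in FILING FORM (b″) (critic FILING RULING 2026-08-30T05:09:06Z;
standing rules 03:00:14Z / 03:45:00Z; precedents RootDecompHoleCountCells, RootDecompScaleTopology)
of Theses/RootDecompHoleCountCells.lean (node N2c), itself the form-(b) sibling of
Theses/RootDecompTrappedBasinCells.lean (N2b) under Theses/RootDecompCausalCells.lean (N2): this
file = node N2e «FinalChargeCells». The route is BORN with its top level BY SIGNATURE only — the
HoleCountCells top level with SingleHoleCaptureExit 26645 replaced by its two born children: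
BoundedSingleExit = stmt-27603, CascadeSingleExit = 27604 (support, thin bridge ⟸ stmt-13847),
MultiHoleCaptureExit = 26646, InfiniteHoleCaptureExit = 26647, TrappedNakedExit = 25598,
TrappedExtremalExit = 25599, ExtremalThresholdExit = 24765, DispersiveExit = 24766,
NakedThresholdExit = 24767 (support) — and `closes` over exactly these nine is
RootDecompHoleCountCells' `closes` with the SingleHoleCaptureExit dispatch replaced inline by one
excluded middle on the future census «CenFinF d» (to 27603 / 27604) (folder/n2f/glue.lean,
kernel-checked rc 0 in folder/n2f/Sketch.lean, cone 9/9); the lens-5 g5 cut is then filed ON THIS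
ROUTE as the GLUED SPLIT of BoundedSingleExit (`--split BoundedSingleExit --into
SubextremalChargeExit HeavyChargeDoor HeavyChargeExit LightChargeExit NoChargeExit --glue
'SubextremalChargeExit → HeavyChargeDoor → HeavyChargeExit → LightChargeExit → NoChargeExit →
BoundedSingleExit'`; five children = the planner-approval case of D-0019, approved by the critic's
ruling: «5 = free Boolean tree on 3 predicates + door; exact; 15 items at cap»), because 27603 is a
layer-2 item on its home route. THE MOVE (new on this summit): cut the parked single-final-hole
residual in FATE currency by the MONOTONE ASYMPTOTIC CHARGES of the datum's own maximal developments
— the final Bondi rest mass MassF (⨅ over asymptotically round receding families of Hawking-mass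
limits, Literature CutBondiMass) and the final horizon area AreaF (sup over all future Cauchy cuts
of area(Σ′ ∩ 𝓗⁺), Literature area / futureEventHorizon; slicing-independent by construction) — read
through the Kerr area–mass dictionary A_Kerr = 8πM²(1 + √(1 − χ²)) ∈ (8πM², 16πM²]: Penrose's 1973
heuristic chain (area law ↑, Bondi loss ↓, Penrose inequality) read BACKWARDS as a partition. Pieces
(exact, free; lets Acc = the books close MGHD-coherently with M_f ≤ m_ADM chartwise, KerrB = 8πM_f²
< A_f ≤ 16πM_f², HeavyB = A_f ≤ 8πM_f², Hor = lens-1's horizon let of 26560 verbatim): K =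
SubextremalChargeExit (Acc ∧ KerrB — NEW RESIDUAL, the candidate final Kerr (M_f, χ_f) PINNED by two
monotone scalars, residual = pure rate statement toward a named target; INSTRUMENTABLE; IDEA-NEEDED;
RE-PARKED: χ-band sub-splits are exact but DECORATIVE under caution c4 until a «charge ⇒ slice-norm»
rung exists), Dr = HeavyChargeDoor (Acc ∧ ¬KerrB ∧ HeavyB ∧ Hor — THIN, support, EMPTY BY BRIDGE:
lens kernel heavyChargeDoor_of_bridge : HorizonAreaBridge → HeavyChargeDoor by the chain 16π(0.81)m²
≤ A_min ≤ A_f ≤ 8πM_f² ≤ 8πm², 12.96 > 8; its registered kill path HorizonAreaBridge (A_min ≤ A_f;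
PDE-free porting: invisibility of the trapped region HawkingEllis1973 Prop. 9.2.8 / Wald1984 §12.2,
far region visible, Lipschitz enclosure comparison) does not fit the 15-item cap and is queued as
porting request D5), L = HeavyChargeExit (Acc ∧ ¬KerrB ∧ HeavyB ∧ ¬Hor — SPECIAL-TYPE: extremal end
state A_f = 8πM_f² or an eternal exterior reservoir; IDEA-NEEDED: vacuum third law, no-periodic /
no-reservoir), H = LightChargeExit (Acc ∧ A_f > 16πM_f² — IDEA-NEEDED = the LIMITING-Bondi-mass
Penrose inequality at late times, print-adjacent: Alexakis arXiv:1506.06400, quasi-final-state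
Penrose inequality arXiv:2605.18730, Le arXiv:2404.17137, Roesch arXiv:1609.02875), N = NoChargeExit
(¬Acc — UNDECIDED Bondi-account / 𝓘⁺-regularity cell, adjacent to but outside the
NonSmoothNullInfinity barrier class). Every junk corner of the ENNReal-valued charges (empty family
⇒ ⊤ ⇒ ¬Acc ⇒ N; clipped negatives ⇒ H/L corners) falls in a conjecturally-EMPTY cell, none in the
residual (critic note c9); c4 honoured (no norm anywhere), c7/c8 IMMUNE BY CONSTRUCTION (monotone
𝓘⁺/𝓗⁺-anchored charges: no window, no tolerance, no transported slice norm). DOMINATION POINTER: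
«27603 ⟺ K ∧ Dr ∧ L ∧ H ∧ N; attack Dr NOW via D5 HorizonAreaBridge (porting, kernel bridge) and by
restriction of 26560; K RE-PARKED; NOT 27603». The whole AND/OR tree is kept in HOME/TREE.md (HOME =
run/shared/lean/pub/decomp-fsc).
Lean: `BoundedSingleExit ∧ CascadeSingleExit ∧ MultiHoleCaptureExit ∧ InfiniteHoleCaptureExit ∧
TrappedNakedExit ∧ TrappedExtremalExit ∧ ExtremalThresholdExit ∧ DispersiveExit ∧
NakedThresholdExit` (the nine by-signature decls of this file; `closes` in folder/n2f/glue.lean; the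
lens-5 g5 cells enter as the glued split of BoundedSingleExit)

## Assembly
Pure logic inside `closes` (folder/n2f/glue.lean = RootDecompHoleCountCells' closes₈ with the
SingleHoleCaptureExit dispatch replaced INLINE by one excluded middle on the future census CenFinF d
sending the datum to BoundedSingleExit or CascadeSingleExit — the proved shape of HoleCountCells'
glue item 27605 —, then the born N2b/N2c case analysis: dispersive / trapped (single, finitely many,
infinitely many future holes; naked; extremal) / threshold-by-P_w; 0 sorry; kernel-checked in
folder/n2f/Sketch.lean with the five children and the bridge one-liner elaborating alongside; #print
axioms closes = {propext, Classical.choice, Quot.sound}). Binders consumed: all nine (cone 9 — one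
thesis, not two: the nine are exactly the leaves of ONE born basin N2 → N2b → N2c; the count exceeds
seven only because D-0019 forces layer-2 items to the top level of a sibling before they can be cut;
seven are cruxes, DispersiveExit and NakedThresholdExit are supports on this route (per-route
kinding; CascadeSingleExit is conjecture-grade for the gate — it reaches the cascade conjecture
stmt-13847 — hence a crux here)). Assembly item below = the schema's mandatory assembly record
(exempt from the cone).

Rationale: WHY THIS LINE. Population splits of the exceptional set are free and exact (critic
`fsc_iff_cellSplit`; tame genericity is monotone but not ∧-closed, tree
`isTameChristodoulouGeneric_and_fails`), hence judged on content, and this sibling exists for one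
reason: to carry the critic-cleared FUTURE-CENSUS carve of the deepest trapped-side residual of the
tree (stmt-26645, one final hole) where the gate allows it (max_depth 1 on the home route). The
carve isolates the ONLY place the census conjecture enters the trapped branch as ONE certified
implication — CascadeSingleExit ⟸ stmt-13847 FiniteCensus (route CriticalAncestry), kernel
`cascadeSingleExit_of_finiteCensus` (an unbundled future Cauchy slice of an MGHD is a
`CauchyDevelopment D′` with the same spacetime, so 13847's bound applies verbatim) — instead of
leaving it hidden inside every residual (census row RT7); the census, used elsewhere in the tree
only as an ∀-data HYPOTHESIS («finite ⟹ settles», stmt-13848), becomes a CELL BOUNDARY and assumes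
nothing; it is cut by BOUNDEDNESS only, never by a census value (answers OBJECTION 03:45:00Z O3),
and only on slices in J⁺ of the data (O1). The complementary piece BoundedSingleExit is declared
plainly as 26645's residual renamed (no endgame difficulty removed) and PARKED; the lens's finding,
adopted by the critic as caution c8 (radiation memory of i⁰-weighted Cauchy norms: late-slice
induced data of a radiating development never become Hˢ_δ-close to Kerr, arXiv:0811.0354 p.22,
arXiv:0910.4957 p.4, arXiv:2104.08222 p.3/p.100, arXiv:2104.11857 p.43/p.51), says why the honest
asymptotic-regime cut («the far future enters a Kerr-stability basin») must be typed on
𝓘⁺-transversal leaves (double-null seed energy / KS initial-data-layer norm) — definitions the tree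
lacks (requests D1–D3 below). Imported from Lorentzian geometry: outermost MOTS / trapped region
structure (AnderssonMetzgerTrapped2009, Hawking–Ellis §9.2) as audited tree vocabulary
(`OutermostMOTS`, `IsCauchyHypersurface`, `causalFuture`), and the characteristic/ layer stability
theorems DafermosHolzegelRodnianskiTaylor2021, KlainermanSzeftel2023 as the named tools of the
parked branch's future rung.

RANKED CRUXES. #2 BoundedSingleExit (crux) — = the BORN item stmt-FinalStateConjecture-27603 of
route-FinalStateConjecture-RootDecompHoleCountCells (node N2c; born there as layer-2 child of
SingleHoleCaptureExit 26645), reused BY SIGNATURE (dedup-attach); INTERNAL NODE (PARKED residual) —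
a layer-2 item on its home route (D-0019 forbids a third layer there), so HERE, immediately after
birth, it receives the critic-CLEARED (2026-08-30T05:09:06Z) lens-5 g5 cut «FinalChargeCells» as its
glued split on THIS route: SubextremalChargeExit ∧ HeavyChargeDoor ∧ HeavyChargeExit ∧
LightChargeExit ∧ NoChargeExit, exact free Boolean tree on the three charge predicates Acc / KerrB /
HeavyB + the horizon door Hor (lens kernel boundedSingleExit_iff_cells, glue bounded_of_cells); text
as born: [crux · NEW RESIDUAL · INTERNAL NODE · PARKED] lens-5 g4 «FutureCensusCarve» child 1 of
SingleHoleCaptureExit (stmt-26645; critic option (A) of OBJECTION 03:45:00Z, CLEARED[split]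
2026-08-30T04:18:58Z): the single-final-hole capture cell 𝓒 (admissible, not dispersive, every MGHD
traps, complete 𝓘⁺, weak C⁰-Kerr fails, at most one final hole) AND CenFinF d := for every MGHD
there is n such that every FUTURE Cauchy slice (range ι′ ⊆ J⁺(range 𝒟.embed); slice unbundled
cast-free as (X′, D′, ι′, ν′) with IsSmoothEmbedding / future unit normal / pullbackBilin /
secondFundamentalForm / IsCauchyHypersurface) carries no n+1 pairwise-disjoint outermost-MOTS bodies
(census clause byte-identical to … (full text as born on the home route) [difficulty: open-problem]
(why it might fail: It is 26645's residual renamed: a tame-open family of censored single-hole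
developments that never become C⁰-close to subextremal Kerr (eternal ringing / non-Kerr hair at
finite a) refutes it and S as typed; KerrSuperradiance, SlowlyRotatingKerrFrontier bite every road.)
[arXiv:0805.3880, KlainermanSzeftel2023, GiorgiKlainermanSzeftel2022,
DafermosHolzegelRodnianskiTaylor2021, arXiv:2606.28253, arXiv:0902.1173, HawkingEllis1973,
arXiv:2104.08222, arXiv:2104.11857]
#3 MultiHoleCaptureExit (crux) — = the BORN item stmt-FinalStateConjecture-26646 of
route-FinalStateConjecture-RootDecompTrappedBasinCells (node N2b; top level by signature on N2c),
reused BY SIGNATURE (dedup-attach); text as born: = the BORN gen-1 child of TrappedCaptureExit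
(stmt-25597) on route-FinalStateConjecture-RootDecompTrappedBasinCells, reused BY SIGNATURE; text as
born: [crux · child 𝓣₂² of TrappedCaptureExit · SPECIAL-TYPE (configurational) · INSTRUMENTABLE;
CLEARED by decomp-fsc-crit-1-g0 2026-08-30T03:23:32Z (k = 3 chosen); writer glue/exactness
folder/n2bg3/Sketch.lean rc 0 / 0 sorry.] For every Σ and every admissible P_Σ-exceptional datum d
of the capture … (full text as born on the home route) [difficulty: open-problem] (why it might
fail: A tame-open set of admissible data whose MGHD keeps two holes on an eternal quasi-periodic
censored orbit (a vacuum 'floating' binary), or n ≥ 3 co-axial multi-Kerr(–NUT) equilibria that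
exist AND are attained from an open set, would refute it; n ≥ 3 non-existence is open (CCH12 p.14).)
[doi:10.1007/BF00770326, arXiv:0905.4179, arXiv:1103.5248, arXiv:1105.5830, arXiv:1111.1448,
arXiv:0811.1727, arXiv:1205.6112, arXiv:gr-qc/0210103, arXiv:2210.13960, arXiv:2001.10401,
arXiv:1904.04831, arXiv:0710.3823]
#4 InfiniteHoleCaptureExit (crux) — = the BORN item stmt-FinalStateConjecture-26647 of
route-FinalStateConjecture-RootDecompTrappedBasinCells (node N2b; by signature on N2c), reused BY
SIGNATURE (dedup-attach); text as born: = the BORN gen-1 child of TrappedCaptureExit (stmt-25597) on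
route-FinalStateConjecture-RootDecompTrappedBasinCells, reused BY SIGNATURE; text as born: [crux ·
child 𝓣₂^∞ of TrappedCaptureExit · thin · conjecturally EMPTY · IDEA-NEEDED; CLEARED by
decomp-fsc-crit-1-g0 2026-08-30T03:23:32Z (k = 3 chosen); writer glue/exactness
folder/n2bg3/Sketch.lean rc 0 / 0 sorry.] For every Σ and every admissible P_Σ-exceptional datum d
of the capture cell 𝓣₂ … (full text as born on the home route) [difficulty: open-problem] (why it
might fail: Late-time tails refocusing through an already formed hole's strong field (caustics near
photon spheres) could keep forming ever smaller holes at ever later times on a tame-open set; no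
statement either way is in print (arXiv:2210.13960 p.6).) [arXiv:0805.3880, arXiv:1409.6270,
Christodoulou1999, arXiv:0811.0354, arXiv:2210.13960, HawkingEllis1973]
#5 TrappedNakedExit (crux) — = the BORN item stmt-FinalStateConjecture-25598 of
route-FinalStateConjecture-RootDecompTrappedBasinCells (node N2b), reused BY SIGNATURE
(dedup-attach); text as born: = the BORN N2b item stmt-FinalStateConjecture-25598 reused BY
SIGNATURE (dedup-attach), text as born (abridged; full docstring in
Theses/RootDecompTrappedBasinCells.lean): PIECE 𝓣₁ — TrappedNakedExit [WEAKER·COUNTS·SPECIAL-TYPE —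
critic CLEARED 2026-08-30T02:40:09Z; weak cosmic censorship AFTER trapping (cell empty in the
spherical scalar-field model doi:10.1088/0264-9381/22/11/019, expected codim ≥ 1 in vacuum);
subsumes lens-5's … (full text as born on the home route) [difficulty: open-problem] (why it might
fail: a tame-open set of admissible vacuum data whose MGHD traps a sphere AND forms a naked
singularity outside the resulting black hole (smooth-data analogue of the Hölder-class stability
arXiv:2605.16235), or incompleteness of 𝓘⁺ generated by the black-hole region itself on an open
set.) [doi:10.1088/0264-9381/22/11/019, arXiv:2402.10190, arXiv:2211.15742, arXiv:1912.08478,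
arXiv:2204.09891, arXiv:1407.4766, arXiv:2605.16235, Christodoulou1999]
#6 TrappedExtremalExit (crux) — = the BORN item stmt-FinalStateConjecture-25599 of
route-FinalStateConjecture-RootDecompTrappedBasinCells (node N2b), reused BY SIGNATURE
(dedup-attach); text as born: = the BORN N2b item stmt-FinalStateConjecture-25599 reused BY
SIGNATURE (dedup-attach), text as born (abridged; full docstring in
Theses/RootDecompTrappedBasinCells.lean): PIECE 𝓣₃ — TrappedExtremalExit [WEAKER·COUNTS·SPECIAL-TYPE
— critic CLEARED 2026-08-30T02:40:09Z; generic THIRD LAW after trapping (transversal crossing of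
|a_f|/M_f = 1 along a tame line) + pointwise C⁰→C² upgrade at sub-extremal members (content pinned
by … (full text as born on the home route) [difficulty: open-problem] (why it might fail: the set of
trapped data with exactly extremal remnants could be tame-thick (accumulating on itself along every
tame line through a member), or every tame exit from it could pass through uncensored data; vacuum
extremal Kerr formation itself is open (arXiv:2402.10190 p.12).) [arXiv:2211.15742,
arXiv:2402.10190, arXiv:2304.08455, Aretakis2015, arXiv:1402.7034, Israel1986]
#7 ExtremalThresholdExit (crux) — = the BORN item stmt-FinalStateConjecture-24765 of
route-FinalStateConjecture-RootDecompCausalCells (node N2), reused BY SIGNATURE (dedup-attach); text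
as born: = the BORN N2 item stmt-FinalStateConjecture-24765 reused BY SIGNATURE (dedup-attach;
declared kind SUPPORT on this route only to respect the 7-crux cap — it stays a crux on its home
routes N2/N2b and is LOAD-BEARING in `closes` here), text as born: PIECE 𝓝∧P_w —
ExtremalThresholdExit [WEAKER·thin — critic CLEARED 2026-08-30T01:39:13Z with retag: the printed
Kehle–Unger exit family (arXiv:2402.10190 Thm 1, Einstein–Maxwell–Vlasov) is a … (full text as born
on the home route) [difficulty: open-problem] (why it might fail: the extremal critical set B_crit
could be thick in the tame topology (extremal thresholds accumulating on themselves along every tame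
line), or leaving the threshold could land in naked data; vacuum extremal formation itself is open
(arXiv:2402.10190 p.12).) [arXiv:2402.10190, arXiv:2211.15742, arXiv:2304.08455]
#8 CascadeSingleExit (crux) — = the BORN item stmt-FinalStateConjecture-27604 of
route-FinalStateConjecture-RootDecompHoleCountCells (node N2c; layer-2 child of 26645; THIN BRIDGE ⟸
stmt-13847, kernel-certified), reused BY SIGNATURE (dedup-attach); text as born: [support · THIN
BRIDGE ⟸ stmt-13847 · conjecturally VACUOUS · dominated] lens-5 g4 «FutureCensusCarve» child 2 of
SingleHoleCaptureExit (stmt-26645; CLEARED[split] 2026-08-30T04:18:58Z): the cell 𝓒 AND ¬CenFinF d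
(one final hole, yet some MGHD carries future Cauchy slices with arbitrarily many pairwise-disjoint
outermost-MOTS bodies) — admits a tame injective exit line with P verbatim. Registered kill path:
stmt-13847 CriticalAncestry.FiniteCensus ⟹ this item, kernel-certified by the lens as
cascadeSingleExit_of_finiteCensus : FiniteCensusR → CascadeSingleExit (an unbundled future slice IS
a CauchyDevelopment D′ with rfl-same spacetime; FiniteCensusR = character-identical copy of 13847 …
(full text as born on the home route) [difficulty: open-problem] (why it might fail: Vacuous iff
13847 FiniteCensus holds on the cell; a single-final-hole development whose future slices carry
unboundedly many disjoint shrinking outermost-MOTS bodies (not excluded by Penrose-type area/mass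
heuristics) would make it contentful and as hard as 26645 there.) [HawkingEllis1973,
AnderssonMetzgerTrapped2009, arXiv:0805.3880, arXiv:1407.4766, doi:10.1103/PhysRevLett.14.57]
#9 DispersiveExit (support) — = the BORN item stmt-FinalStateConjecture-24766 of
route-FinalStateConjecture-RootDecompCausalCells (node N2), reused BY SIGNATURE (dedup-attach); text
as born: = the BORN N2 item stmt-FinalStateConjecture-24766 reused BY SIGNATURE (dedup-attach;
declared kind SUPPORT on this route only to respect the 7-crux cap — it stays a crux on its home
routes N2/N2b and is LOAD-BEARING in `closes` here), text as born: PIECE 𝓒 — DispersiveExit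
[WEAKER·thin — critic CLEARED 2026-08-30T01:39:13Z; implied outright by the registered pointwise
item stmt-FinalStateConjecture-17320 … (full text as born on the home route) [difficulty:
open-problem] (why it might fail: a non-radiating vacuum breather or a complete development with
curvature not decaying at i⁺ whose tame neighbours are also exceptional (an open set) refutes it;
no-breather results hold only near 𝓘 (arXiv:1504.04592) or for decaying solutions
(arXiv:2108.13379).) [arXiv:2108.13379, arXiv:1504.04592, doi:10.1007/PL00001021]
#9 NakedThresholdExit (support) — = the BORN item stmt-FinalStateConjecture-24767 of
route-FinalStateConjecture-RootDecompCausalCells (node N2), reused BY SIGNATURE (dedup-attach); text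
as born: = the BORN N2 item stmt-FinalStateConjecture-24767 reused BY SIGNATURE (dedup-attach;
declared kind SUPPORT on this route only to respect the 7-crux cap — it stays a crux on its home
routes N2/N2b and is LOAD-BEARING in `closes` here), text as born: PIECE 𝓝∧¬P_w — NakedThresholdExit
[WEAKER·COUNTS — critic CLEARED 2026-08-30T01:39:13Z; = weak cosmic censorship on the untrapped
incomplete sector in Christodoulou's own codimension form (the … (full text as born on the home
route) [difficulty: open-problem] (why it might fail: a smooth-data analogue of the Singh–Zheng
stability — a tame-open set of admissible vacuum data forming naked singularities (RSR
arXiv:1912.08478 exteriors are fine-tuned, consistent so far).) [Christodoulou1999,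
arXiv:1912.08478, arXiv:2204.09891, arXiv:2605.16235, arXiv:0811.0354]

TWO-LAYER PLAN. Layer 2 here = {SubextremalChargeExit, HeavyChargeDoor, HeavyChargeExit,
LightChargeExit, NoChargeExit} under BoundedSingleExit (filed as the glued split right after birth;
glue item provable now by the lens proof bounded_of_cells). Foreseen, NOT filed (cap): the support
HorizonAreaBridge (A_min ≤ A_f; lens one-liner HorizonAreaBridge.oneline.txt, 7844 chars, elaborates
in folder/n2f/Sketch.lean) = the registered kill path of HeavyChargeDoor, queued as porting request
D5 with the three porting facts F1 (invisibility of the outermost-MOTS body from the complete-ray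
region, HawkingEllis1973 9.2.8 / Wald1984 12.2.4), F2 (far AF region visible), F3 (Lipschitz GMT
enclosure comparison A_min ≤ area of the horizon cut); a prover may land «HorizonAreaBridge →
HeavyChargeDoor» verbatim from the lens kernel with --supports <Dr item>. Beneath K nothing until a
«charge ⇒ slice-norm» rung exists (RE-PARKED; χ-band sub-splits decorative under c4); beneath L/H/N
idea-leaves only.

KILL CRITERIA. All nine binders and all five split children are S-implied in the lens kernel
(necessity ×5), so a refutation of any of them — a tame-open set of exceptional data inside one
cell: censored single-hole data with Kerr-compatible books that never settle or settle to non-Kerr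
(K), heavy books coexisting with an honest outermost horizon (Dr — would refute HorizonAreaBridge,
i.e. the sojourn-form invisibility of trapped regions or the enclosure comparison: a typing
finding), a dynamically formed extremal vacuum horizon or eternal exterior reservoir on an open set
(L — the vacuum third law failing generically), horizon area outgrowing 16πM_f² tame-stably (H — the
late-time Penrose inequality failing generically), large censored developments with no Bondi account
at all on an open set (N) — refutes the summit AS TYPED and closes this route `refuted:<Decl>`; each
feeds the statement audit, not a pivot. Mooted piecewise: Dr closes when D5 HorizonAreaBridge is
ported (kernel bridge); all five are mooted by a direct proof of 27603 on HoleCountCells or of 26645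
/ 25597 / 24764 upstream. Superseded if the critic retires this cut of 27603 in favour of another.

NOT DECOMPOSED YET. SubextremalChargeExit's interior (rate of convergence of a censored single-hole
development to the PINNED sub-extremal Kerr(M_f, χ_f): the large-data Kerr stability problem proper,
arXiv:2104.11857 / arXiv:2205.14808 only perturbatively) is famous-grade and deliberately not
decomposed (RE-PARKED: χ-band sub-splits by χ_f read off (M_f, A_f) are exact and window-free but
decorative under caution c4 until a charge-to-slice-norm rung exists); L, H, N are idea-leaves
(third law; limiting-Bondi-mass Penrose inequality; Bondi account for large data); constants (0.81,
0.785, 8π, 16π) enter cell GUARDS only, never `closes`' binders as hypotheses on S.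

CHEAPEST FALSIFIER. HeavyChargeDoor / D5: port HorizonAreaBridge (PDE-free: HE 9.2.8 invisibility of
the trapped region + far-region visibility + GMT enclosure comparison) — if the sojourn-form
exterior makes the outermost trapped body visible from the complete-ray region, Dr is not empty as
typed (statement-audit finding); expected to go through. LightChargeExit: a censored NR development
with final horizon area > 16πM_f² for the limiting Bondi mass (none known). HeavyChargeExit: a
VACUUM analogue of Kehle–Unger extremal formation arXiv:2211.15742 on an open set (open problem).
NoChargeExit: a large censored development with no Hawking-mass limit along any round receding
family (Mars–Soria arXiv:1506.01545 is the warning sign). SubextremalChargeExit: an NR catalogue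
entry with Kerr-compatible books and permanent hair on an OPEN set (none: SXS arXiv:1904.04831). The
route dies cheaply if a by-signature attach or the five-way split is refused (fallbacks β / (a) in
the lens kit split.json).

NUMBERS. Print only: binary-merger remnants |a_f|/M_f ≲ 0.95 and 100 % merger-or-scatter outcomes in
the SXS catalogue (arXiv:1904.04831); instrument budgets C-g3-1 10–20 core-h, C-g3-2 10–30 core-h
(lens-5 memo). No constant enters a binder.

DEFINITION REQUESTS. D5 (NEW, porting request, queued by the writer right after birth per the
critic's ruling): «HorizonAreaBridge» — statement = lens kernel decl verbatim
(decomp-fsc-lens-5/g5/HorizonAreaBridge.oneline.txt: A_min(S) ≤ AreaF for censored single-hole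
developments), with the porting facts F1 invisibility of the outermost-MOTS body from the
complete-ray region (HawkingEllis1973 Prop. 9.2.8, Wald1984 Props. 12.2.2–12.2.4), F2 far AF region
visible, F3 Lipschitz GMT enclosure comparison (ChruscielEtAl2001 §3 (3.9), §4); --for the
HeavyChargeDoor item. No new `def` is needed: every let elaborates over existing declarations
(CutBondiMass, area, futureEventHorizon, minimalEnclosureArea). Pending cell requests D1–D4
(defn-ConeSeedData, wi-96534/96535/96536, defn-InitialDataSet.charWeightedEDist) concern the
entry-side residuals.

Novelty: GEN-5 on 27603 (2026-08-30T05:03:50Z, lens-5 g5 + critic 05:09:06Z + writer): the move = cut a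
fate-side residual by MONOTONE ASYMPTOTIC CHARGES of the datum's own MGHD (final Bondi rest mass,
final horizon area) read through the Kerr area–mass band — Penrose's 1973 heuristic chain read
backwards as an exact partition; the only node in the tree using 𝓘⁺/𝓗⁺-side limit quantities and a
monotone law as the cutting tool, immune to cautions c7/c8 by construction. Searches (lens-5,
2026-08-30, NODE-g5.md §6, corpus fts+vec AND galaxy, labelled): `lit search --hybrid "Penrose
inequality Bondi mass null hypersurface late time"` → [corpus:paper:arxiv-1506.06400 p.5, p.17]
(Alexakis, null Penrose inequality near Schwarzschild), [corpus:paper:arxiv-2605.18730 p.2–4]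
(quasi-final-state Penrose inequality), [corpus:paper:arxiv-1609.02875] (Roesch); `lit search "area
theorem event horizon Hawking Chrusciel Delay Galloway Howard"` → [corpus:ChruscielEtAl2001 §3–4];
`lit search "third law black hole extremal Kehle Unger"` → [corpus:paper:arxiv-2211.15742],
[corpus:paper:arxiv-2402.10190]; `lit vsearch "final Bondi mass and final horizon area determine the
Kerr parameters of the end state"` → reviews only (no partition-by-charges of the exceptional set);
`lit galaxy search "Bondi mass loss|area theorem|Penrose inequality" --star all` →
textbook/lecture-note rows (Wald, Hawking–Ellis) and [galaxy:pdf] Mars–Soria arXiv:1506.01545 p.3;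
null in corpus (fts+vec) and galaxy for «classification of n  [refs: 10.1111/j.1749-6632.1973.tb41447.x, 1506.01545, 1506.06400, 2605.18730, 2104.08222, 2104.11857, paper:arxiv-1506.06400, paper:arxiv-2605.18730, paper:arxiv-1609.02875, paper:arxiv-2211.15742, paper:arxiv-2402.10190, doi:10.1111/j.1749-6632.1973.tb41447.x, arxiv-0811.0354, arxiv-0910.4957, arxiv-2104.08222, arxiv-2104.11857, ChruscielEtAl2001, HawkingEllis1973, AnderssonMetzgerTrapped2009]

Barriers (technique_class: population-split, monotone charges, Kerr area-mass band): - technique_class: population-split, monotone charges, Kerr area-mass band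
- Literature.Barriers.FinalStateConjecture.nakedSingularityInstability: genericity-blind methods
excluded; NakedThresholdExit / TrappedNakedExit / all pieces are the GENERIC (tame-curve) forms —
outside the class; the barrier's own theorem (Christodoulou 1999 Thm 4.1) is the model exit family.
- Literature.Barriers.FinalStateConjecture.AretakisInstability: bites settling ON an extremal
horizon and every uniform-in-spin road inside TrappedCaptureExit; ExtremalThresholdExit and
TrappedExtremalExit only ask to LEAVE the extremal cell along a tame curve — outside (critic
placement 02:40:09Z); inside TrappedCaptureExit near-extremal capture roads it is declared, not
evaded.
- Literature.Barriers.FinalStateConjecture.AretakisInstabilityNarrow: uniform-in-spin non-degenerate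
horizon estimates are NOT used anywhere: the cut is by monotone charges, the Kerr band guard 8πM_f²
< A_f ≤ 16πM_f² is finite-range arithmetic (kernel spin_margin_of_ratio gives |χ_f| < 0.785 only
inside a sub-cell guard, never a κ-independent estimate); the extremal corner A_f = 8πM_f² is
isolated in its own cell HeavyChargeExit, whose bet is a vacuum third law, i.e. it does not evade
the barrier there; the bet is that extremal formation is non-generic.
- Literature.Barriers.FinalStateConjecture.HairyKerrBifurcationNarrow: scope (massive Klein–Gordon
hair bifurcating from Kerr): vacuum here, no matter field; the residual SubextremalCharg

sub-problem: FinalStateConjecture · status: draft · opened planner-decomp-fsc-writer-1-g0-0 2026-08-30T05:18:56Z · rev 1 · ledger route-FinalStateConjecture-RootDecompFinalChargeCells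
GENERATED by the gate from the ledger (D-0016/17). Provers cite these decls: `theorem foo : Summit.FinalStateConjecture.FinalStateConjecture.Theses.RootDecompFinalChargeCells.<Decl> := …` in Summits/FinalStateConjecture/FinalStateConjecture/Theorems/<Name>.lean.
-/

namespace Summit.FinalStateConjecture.FinalStateConjecture.Theses.RootDecompFinalChargeCells

open scoped BigOperators Topology Manifold Classical MeasureTheory ProbabilityTheory Matrix InnerProductSpace ComplexConjugate ContinuousMap
open Filter Set Function TopologicalSpace MeasureTheory

attribute [summit_statement] _root_.FinalStateConjecture

/-- item stmt-FinalStateConjecture-27603 · crux · rank 2 · SPLIT (gen 1) into SubextremalChargeExit, HeavyChargeDoor, HeavyChargeExit, LightChargeExit, NoChargeExit + glue BoundedSingleExitGlue · direct attempts still welcome (low priority) · by planner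
why it might fail: It is 26645's residual renamed: a tame-open family of censored single-hole developments that never become C⁰-close to subextremal Kerr (eternal ringing / non-Kerr hair at finite a) refutes it and S as typed; KerrSuperradiance, SlowlyRotatingKerrFrontier bite every road.
sources: arXiv:0805.3880, KlainermanSzeftel2023, GiorgiKlainermanSzeftel2022, DafermosHolzegelRodnianskiTaylor2021, arXiv:2606.28253, arXiv:0902.1173
[crux · NEW RESIDUAL · INTERNAL NODE · PARKED] lens-5 g4 «FutureCensusCarve» child 1 of
SingleHoleCaptureExit (stmt-26645; critic option (A) of OBJECTION 03:45:00Z, CLEARED[split]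
2026-08-30T04:18:58Z): the single-final-hole capture cell 𝓒 (admissible, not dispersive, every MGHD
traps, complete 𝓘⁺, weak C⁰-Kerr fails, at most one final hole) AND CenFinF d := for every MGHD
there is n such that every FUTURE Cauchy slice (range ι′ ⊆ J⁺(range 𝒟.embed); slice unbundled
cast-free as (X′, D′, ι′, ν′) with IsSmoothEmbedding / future unit normal / pullbackBilin /
secondFundamentalForm / IsCauchyHypersurface) carries no n+1 pairwise-disjoint outermost-MOTS bodies
(census clause byte-identical to stmt-13847's) — admits a tame injective line of admissible data
through d whose other members satisfy P verbatim. Lets P/Pw0/Disp/Trap/Cens/Single byte-identical to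
the born 26645; one new let CenFinF. = 26645 minus a conjecturally empty sliver: NO endgame
difficulty removed (large-data exterior Kerr stability at C⁰ + rigidity + no eternally radiating
censored single hole); PARK RULE: no further cut without an attackable norm-matched rung, which by
caution c8 (radiation memory of i⁰-weighted Cauchy -/
@[route_item "route-FinalStateConjecture-RootDecompFinalChargeCells", crux]
def BoundedSingleExit : Prop :=
  ∀ (X : Type) [TopologicalSpace X] [ChartedSpace Literature.Geometry.Lorentzian.E3 X] [IsManifold (𝓡 3) ((⊤ : ℕ∞) : WithTop ℕ∞) X] [T2Space X] [SecondCountableTopology X] [ConnectedSpace X], let P : Literature.Geometry.Lorentzian.InitialDataSet (𝓡 3) X → Prop := fun D ↦ (∃ 𝒟 : Literature.Geometry.Lorentzian.VacuumCauchyDevelopment D, 𝒟.IsMaximal) ∧ ∀ 𝒟 : Literature.Geometry.Lorentzian.VacuumCauchyDevelopment D, 𝒟.IsMaximal → Summit.FinalStateConjecture.HasCompleteNullInfinity 𝒟.toCauchyDevelopment ∧ ∃ (O : Set 𝒟.carrier) (d : Literature.Geometry.Lorentzian.FinalStateDecomposition 𝒟.toSpacetime O 2), (∀ i, Literature.Geometry.Lorentzian.Kerr.IsSubextremal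 (d.mass i) (d.spin i)) ∧ O = Summit.FinalStateConjecture.exteriorOf 𝒟.toCauchyDevelopment d.charted ∧ Summit.FinalStateConjecture.RaysStayInClosure 𝒟.toCauchyDevelopment O ∧ Summit.FinalStateConjecture.HasExhaustiveCharts d ∧ Summit.FinalStateConjecture.IsFutureOriented d; let Pw0 : Literature.Geometry.Lorentzian.InitialDataSet (𝓡 3) X → Prop := fun D ↦ (∃ 𝒟 : Literature.Geometry.Lorentzian.VacuumCauchyDevelopment D, 𝒟.IsMaximal) ∧ ∀ 𝒟 : Literature.Geometry.Lorentzian.VacuumCauchyDevelopment D, 𝒟.IsMaximal → Summit.FinalStateConjecture.HasCompleteNullInfinity 𝒟.toCauchyDevelopment ∧ ∃ (O : Set 𝒟.carrier) (d : Literature.Geometry.Lorentzian.FinalStateDecomposition 𝒟.toSpacetime O 0), O = Summit.FinalStateConjecture.exteriorOf 𝒟.toCauchyDevelopment d.charted ∧ Summit.FinalStateConjecture.RaysStayInClosure 𝒟.toCauchyDevelopment O ∧ Summit.FinalStateConjecture.HasExhaustiveCharts d ∧ Summit.FinalStateConjecture.IsFutureOriented d; let Disp : Literature.Geometry.Lorentzian.InitialDataSet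 (𝓡 3) X → Prop := fun D ↦ (∃ 𝒟 : Literature.Geometry.Lorentzian.VacuumCauchyDevelopment D, 𝒟.IsMaximal) ∧ ∀ 𝒟 : Literature.Geometry.Lorentzian.VacuumCauchyDevelopment D, 𝒟.IsMaximal → ∀ [𝒟.metric.HasLeviCivita], ¬ 𝒟.metric.IsFutureNullGeodesicallyIncomplete 𝒟.timeOrientation ∧ ¬ 𝒟.metric.IsFutureTimelikeGeodesicallyIncomplete 𝒟.timeOrientation; let Trap : Literature.Geometry.Lorentzian.InitialDataSet (𝓡 3) X → Prop := fun D ↦ (∃ 𝒟 : Literature.Geometry.Lorentzian.VacuumCauchyDevelopment D, 𝒟.IsMaximal) ∧ ∀ 𝒟 : Literature.Geometry.Lorentzian.VacuumCauchyDevelopment D, 𝒟.IsMaximal → ∀ [𝒟.metric.HasLeviCivita], ∃ f : Metric.sphere (0 : Literature.Geometry.Lorentzian.E3) 1 → 𝒟.carrier, Set.range f ⊆ 𝒟.metric.causalFuture 𝒟.timeOrientation (Set.range 𝒟.embed) ∧ 𝒟.metric.IsTrappedSurface (𝓡 2) 𝒟.timeOrientation f; let Cens : Literature.Geometry.Lorentzian.InitialDataSet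 (𝓡 3) X → Prop := fun D ↦ ∀ 𝒟 : Literature.Geometry.Lorentzian.VacuumCauchyDevelopment D, 𝒟.IsMaximal → Summit.FinalStateConjecture.HasCompleteNullInfinity 𝒟.toCauchyDevelopment; let Single : Literature.Geometry.Lorentzian.InitialDataSet (𝓡 3) X → Prop := fun D ↦ ∀ 𝒟 : Literature.Geometry.Lorentzian.VacuumCauchyDevelopment D, 𝒟.IsMaximal → ∀ [𝒟.metric.HasLeviCivita], Subsingleton (ConnectedComponents ↥(Literature.Geometry.Lorentzian.DataEmbedding.blackHoleRegion 𝒟.toDataEmbedding ∩ 𝒟.metric.causalFuture 𝒟.timeOrientation (Set.range 𝒟.embed))); let CenFinF : Literature.Geometry.Lorentzian.InitialDataSet (𝓡 3) X → Prop := fun D ↦ ∀ 𝒟 : Literature.Geometry.Lorentzian.VacuumCauchyDevelopment D, 𝒟.IsMaximal → ∃ n : ℕ, ∀ (X' : Type) [TopologicalSpace X'] [ChartedSpace Literature.Geometry.Lorentzian.E3 X'] [IsManifold (𝓡 3) ((⊤ : ℕ∞) : WithTop ℕ∞) X'] [ConnectedSpace X'] (D' : Literature.Geometry.Lorentzian.InitialDataSet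 (𝓡 3) X') (ι' : X' → 𝒟.carrier) (ν' : Literature.Geometry.Lorentzian.NormalField (𝓡 4) ι'), Manifold.IsSmoothEmbedding (𝓡 3) (𝓡 4) ((⊤ : ℕ∞) : WithTop ℕ∞) ι' → 𝒟.metric.IsFutureUnitNormal (𝓡 3) 𝒟.timeOrientation ι' ν' → (∀ y : X', Literature.Geometry.Lorentzian.pullbackBilin (I := 𝓡 4) (I' := 𝓡 3) ι' 𝒟.metric.val y = D'.h.inner y) → (∀ [𝒟.metric.toPseudoRiemannianMetric.HasLeviCivita] (y : X'), 𝒟.metric.toPseudoRiemannianMetric.secondFundamentalForm (𝓡 3) ι' ν' y = D'.kBilin y) → 𝒟.metric.IsCauchyHypersurface 𝒟.timeOrientation (Set.range ι') → Set.range ι' ⊆ 𝒟.metric.causalFuture 𝒟.timeOrientation (Set.range 𝒟.embed) → ∀ S : Fin (n + 1) → Literature.Geometry.Lorentzian.OutermostMOTS (𝓡 3) D'.h D'.k, (∀ j, ConnectedSpace (S j).surf) → (∀ j, IsCompact (((S j).exterior : Set X'))ᶜ ∧ (interior (((S j).exterior : Set X'))ᶜ).Nonempty) → ∃ j j', j ≠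 j' ∧ ((((S j).exterior : Set X'))ᶜ ∩ (((S j').exterior : Set X'))ᶜ).Nonempty; ∀ d ∈ Literature.Geometry.Lorentzian.admissibleVacuumData X, ¬ P d → (((¬ Disp d ∧ Trap d ∧ Cens d ∧ ¬ Pw0 d) ∧ Single d) ∧ CenFinF d) → ∃ (e : Literature.Geometry.Lorentzian.AFEnd X) (F : EuclideanSpace ℝ (Fin 1) → Literature.Geometry.Lorentzian.InitialDataSet (𝓡 3) X), Literature.Geometry.Lorentzian.InitialDataSet.IsTameDataFamily e 1 F ∧ Literature.Geometry.Lorentzian.InitialDataSet.IsImmersedAtZero 1 F ∧ F 0 = d ∧ Injective F ∧ (∀ c, F c ∈ Literature.Geometry.Lorentzian.admissibleVacuumData X) ∧ ∀ c ≠ 0, P (F c)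

-- parent: BoundedSingleExit · child (gen 1)
/--     item stmt-FinalStateConjecture-28422 · crux · rank 201 · open
    parent: BoundedSingleExit · by planner
    why it might fail: Kerr-compatible books (8πM_f² < A_f ≤ 16πM_f²) do not force convergence: no theorem excludes an eternally non-settling censored exterior whose monotone limits sit on a Kerr curve; the χ̄-margin stability theorems consume slice-norm closeness that monotone limits never supply (caution c4).
    sources: arXiv:2104.11857, arXiv:2606.28253, arXiv:2605.18730, arXiv:2205.14808, doi:10.1111/j.1749-6632.1973.tb41447.x
[crux · NEW RESIDUAL · PARKED residual · internal node K of lens-5 g5 «FinalChargeCells» on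
stmt-27603] Admissible non-generic data outside the dispersive and threshold cells whose maximal
developments are censored, trapped, with exactly ONE and finitely many future black holes (the
BoundedSingleExit population) AND whose asymptotic books close MGHD-coherently (Acc: a final Bondi
rest mass MassF = inf over asymptotically round receding families of Hawking-mass limits, ≤ m_ADM in
every AF chart, and a final horizon area AreaF = sup over future Cauchy cuts of area(Σ′ ∩ 𝓗⁺)) with
the books in the KERR BAND 8π·MassF² < AreaF ≤ 16π·MassF² (KerrB), exit tamely with codimension ≥ 1.
The candidate final Kerr (M_f, χ_f) is PINNED by two monotone scalars (χ_f read off A =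
8πM²(1+√(1−χ²))); what remains is a pure RATE statement: convergence of the censored exterior to
that Kerr — the large-data Kerr stability problem proper. RE-PARKED by the critic (05:09:06Z):
χ-band sub-splits are exact and window-free but decorative under caution c4 until a «charge ⇒
slice-norm» rung exists. Instrumentable (NR reads M_f, A_f). Domination: 27603 ⟺ K ∧ Dr ∧ L ∧ H ∧ N
(lens kernel boundedSingleExit_iff_cells) -/
@[route_item "route-FinalStateConjecture-RootDecompFinalChargeCells"]
def SubextremalChargeExit : Prop :=
  ∀ (X : Type) [TopologicalSpace X] [ChartedSpace Literature.Geometry.Lorentzian.E3 X] [IsManifold (𝓡 3) ((⊤ : ℕ∞) : WithTop ℕ∞) X] [T2Space X] [SecondCountableTopology X] [ConnectedSpace X], let P : Literature.Geometry.Lorentzian.InitialDataSet (𝓡 3) X → Prop := fun D ↦ (∃ 𝒟 : Literature.Geometry.Lorentzian.VacuumCauchyDevelopment D, 𝒟.IsMaximal) ∧ ∀ 𝒟 : Literature.Geometry.Lorentzian.VacuumCauchyDevelopment D, 𝒟.IsMaximal → Summit.FinalStateConjecture.HasCompleteNullInfinity 𝒟.toCauchyDevelopment ∧ ∃ (O :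 Set 𝒟.carrier) (d : Literature.Geometry.Lorentzian.FinalStateDecomposition 𝒟.toSpacetime O 2), (∀ i, Literature.Geometry.Lorentzian.Kerr.IsSubextremal (d.mass i) (d.spin i)) ∧ O = Summit.FinalStateConjecture.exteriorOf 𝒟.toCauchyDevelopment d.charted ∧ Summit.FinalStateConjecture.RaysStayInClosure 𝒟.toCauchyDevelopment O ∧ Summit.FinalStateConjecture.HasExhaustiveCharts d ∧ Summit.FinalStateConjecture.IsFutureOriented d; let Pw0 : Literature.Geometry.Lorentzian.InitialDataSet (𝓡 3) X → Prop := fun D ↦ (∃ 𝒟 : Literature.Geometry.Lorentzian.VacuumCauchyDevelopment D, 𝒟.IsMaximal) ∧ ∀ 𝒟 : Literature.Geometry.Lorentzian.VacuumCauchyDevelopment D, 𝒟.IsMaximal → Summit.FinalStateConjecture.HasCompleteNullInfinity 𝒟.toCauchyDevelopment ∧ ∃ (O : Set 𝒟.carrier) (d : Literature.Geometry.Lorentzian.FinalStateDecomposition 𝒟.toSpacetime O 0), O = Summit.FinalStateConjecture.exteriorOf 𝒟.toCauchyDevelopment d.charted ∧ Summit.FinalStateConjecture.RaysStayInClosure 𝒟.toCauchyDevelopment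 O ∧ Summit.FinalStateConjecture.HasExhaustiveCharts d ∧ Summit.FinalStateConjecture.IsFutureOriented d; let Disp : Literature.Geometry.Lorentzian.InitialDataSet (𝓡 3) X → Prop := fun D ↦ (∃ 𝒟 : Literature.Geometry.Lorentzian.VacuumCauchyDevelopment D, 𝒟.IsMaximal) ∧ ∀ 𝒟 : Literature.Geometry.Lorentzian.VacuumCauchyDevelopment D, 𝒟.IsMaximal → ∀ [𝒟.metric.HasLeviCivita], ¬ 𝒟.metric.IsFutureNullGeodesicallyIncomplete 𝒟.timeOrientation ∧ ¬ 𝒟.metric.IsFutureTimelikeGeodesicallyIncomplete 𝒟.timeOrientation; let Trap : Literature.Geometry.Lorentzian.InitialDataSet (𝓡 3) X → Prop := fun D ↦ (∃ 𝒟 : Literature.Geometry.Lorentzian.VacuumCauchyDevelopment D, 𝒟.IsMaximal) ∧ ∀ 𝒟 : Literature.Geometry.Lorentzian.VacuumCauchyDevelopment D, 𝒟.IsMaximal → ∀ [𝒟.metric.HasLeviCivita], ∃ f : Metric.sphere (0 : Literature.Geometry.Lorentzian.E3) 1 → 𝒟.carrier, Set.range f ⊆ 𝒟.metric.causalFuture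 𝒟.timeOrientation (Set.range 𝒟.embed) ∧ 𝒟.metric.IsTrappedSurface (𝓡 2) 𝒟.timeOrientation f; let Cens : Literature.Geometry.Lorentzian.InitialDataSet (𝓡 3) X → Prop := fun D ↦ ∀ 𝒟 : Literature.Geometry.Lorentzian.VacuumCauchyDevelopment D, 𝒟.IsMaximal → Summit.FinalStateConjecture.HasCompleteNullInfinity 𝒟.toCauchyDevelopment; let Single : Literature.Geometry.Lorentzian.InitialDataSet (𝓡 3) X → Prop := fun D ↦ ∀ 𝒟 : Literature.Geometry.Lorentzian.VacuumCauchyDevelopment D, 𝒟.IsMaximal → ∀ [𝒟.metric.HasLeviCivita], Subsingleton (ConnectedComponents ↥(Literature.Geometry.Lorentzian.DataEmbedding.blackHoleRegion 𝒟.toDataEmbedding ∩ 𝒟.metric.causalFuture 𝒟.timeOrientation (Set.range 𝒟.embed))); let CenFinF : Literature.Geometry.Lorentzian.InitialDataSet (𝓡 3) X → Prop := fun D ↦ ∀ 𝒟 : Literature.Geometry.Lorentzian.VacuumCauchyDevelopment D, 𝒟.IsMaximal → ∃ n : ℕ, ∀ (X' : Type) [TopologicalSpace X'] [ChartedSpace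 Literature.Geometry.Lorentzian.E3 X'] [IsManifold (𝓡 3) ((⊤ : ℕ∞) : WithTop ℕ∞) X'] [ConnectedSpace X'] (D' : Literature.Geometry.Lorentzian.InitialDataSet (𝓡 3) X') (ι' : X' → 𝒟.carrier) (ν' : Literature.Geometry.Lorentzian.NormalField (𝓡 4) ι'), Manifold.IsSmoothEmbedding (𝓡 3) (𝓡 4) ((⊤ : ℕ∞) : WithTop ℕ∞) ι' → 𝒟.metric.IsFutureUnitNormal (𝓡 3) 𝒟.timeOrientation ι' ν' → (∀ y : X', Literature.Geometry.Lorentzian.pullbackBilin (I := 𝓡 4) (I' := 𝓡 3) ι' 𝒟.metric.val y = D'.h.inner y) → (∀ [𝒟.metric.toPseudoRiemannianMetric.HasLeviCivita] (y : X'), 𝒟.metric.toPseudoRiemannianMetric.secondFundamentalForm (𝓡 3) ι' ν' y = D'.kBilin y) → 𝒟.metric.IsCauchyHypersurface 𝒟.timeOrientation (Set.range ι') → Set.range ι' ⊆ 𝒟.metric.causalFuture 𝒟.timeOrientation (Set.range 𝒟.embed) → ∀ S : Fin (n + 1) → Literature.Geometry.Lorentzian.OutermostMOTS (𝓡 3)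 D'.h D'.k, (∀ j, ConnectedSpace (S j).surf) → (∀ j, IsCompact (((S j).exterior : Set X'))ᶜ ∧ (interior (((S j).exterior : Set X'))ᶜ).Nonempty) → ∃ j j', j ≠ j' ∧ ((((S j).exterior : Set X'))ᶜ ∩ (((S j').exterior : Set X'))ᶜ).Nonempty; let kerrLo : ENNReal → ENNReal := fun M ↦ ENNReal.ofReal (8 * Real.pi) * M ^ 2; let kerrHi : ENNReal → ENNReal := fun M ↦ ENNReal.ofReal (16 * Real.pi) * M ^ 2; let MassF : (D : Literature.Geometry.Lorentzian.InitialDataSet (𝓡 3) X) → Literature.Geometry.Lorentzian.VacuumCauchyDevelopment D → ENNReal := fun D 𝒟 ↦ ⨅ (K : Set 𝒟.carrier) (_ : IsCompact K) (m : ℝ) (_ : 𝒟.toCauchyDevelopment.HasCutBondiMass K m), ENNReal.ofReal m; let AreaF : (D : Literature.Geometry.Lorentzian.InitialDataSet (𝓡 3) X) → (𝒟 : Literature.Geometry.Lorentzian.VacuumCauchyDevelopment D) → [𝒟.metric.HasLeviCivita] → ENNReal := fun D 𝒟 hLC ↦ sInf {a : ENNReal | ∀ (X' : Type) [TopologicalSpace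 X'] [ChartedSpace Literature.Geometry.Lorentzian.E3 X'] [IsManifold (𝓡 3) ((⊤ : ℕ∞) : WithTop ℕ∞) X'] [ConnectedSpace X'] [T2Space X'] (D' : Literature.Geometry.Lorentzian.InitialDataSet (𝓡 3) X') (ι' : X' → 𝒟.carrier) (ν' : Literature.Geometry.Lorentzian.NormalField (𝓡 4) ι'), Manifold.IsSmoothEmbedding (𝓡 3) (𝓡 4) ((⊤ : ℕ∞) : WithTop ℕ∞) ι' → 𝒟.metric.IsFutureUnitNormal (𝓡 3) 𝒟.timeOrientation ι' ν' → (∀ y : X', Literature.Geometry.Lorentzian.pullbackBilin (I := 𝓡 4) (I' := 𝓡 3) ι' 𝒟.metric.val y = D'.h.inner y) → (∀ [𝒟.metric.toPseudoRiemannianMetric.HasLeviCivita] (y : X'), 𝒟.metric.toPseudoRiemannianMetric.secondFundamentalForm (𝓡 3) ι' ν' y = D'.kBilin y) → 𝒟.metric.IsCauchyHypersurface 𝒟.timeOrientation (Set.range ι') → Set.range ι' ⊆ 𝒟.metric.causalFuture 𝒟.timeOrientation (Set.range 𝒟.embed) → (letI : MeasurableSpace X' := borel X'; haveI : BorelSpace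 X' := ⟨rfl⟩; haveI : LocallyCompactSpace X' := ChartedSpace.locallyCompactSpace Literature.Geometry.Lorentzian.E3 X'; Literature.Geometry.Lorentzian.area D'.h (ι' ⁻¹' Literature.Geometry.Lorentzian.DataEmbedding.futureEventHorizon 𝒟.toDataEmbedding)) ≤ a}; let Acc : Literature.Geometry.Lorentzian.InitialDataSet (𝓡 3) X → Prop := fun D ↦ ∃ (M A : ENNReal), M ≠ ⊤ ∧ (∀ e : Literature.Geometry.Lorentzian.AFEnd X, e.IsAsymptoticallyFlat D 1 → (∃ m, e.HasADMEnergy D m) → M ≤ ENNReal.ofReal (e.admMass D)) ∧ ∀ 𝒟 : Literature.Geometry.Lorentzian.VacuumCauchyDevelopment D, 𝒟.IsMaximal → ∀ [𝒟.metric.HasLeviCivita], MassF D 𝒟 = M ∧ AreaF D 𝒟 = A; let KerrB : Literature.Geometry.Lorentzian.InitialDataSet (𝓡 3) X → Prop := fun D ↦ ∀ 𝒟 : Literature.Geometry.Lorentzian.VacuumCauchyDevelopment D, 𝒟.IsMaximal → ∀ [𝒟.metric.HasLeviCivita], MassF D 𝒟 ≠ ⊤ ∧ kerrLo (MassF D 𝒟)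 < AreaF D 𝒟 ∧ AreaF D 𝒟 ≤ kerrHi (MassF D 𝒟); ∀ d ∈ Literature.Geometry.Lorentzian.admissibleVacuumData X, ¬ P d → (((¬ Disp d ∧ Trap d ∧ Cens d ∧ ¬ Pw0 d) ∧ Single d) ∧ CenFinF d) → (Acc d ∧ KerrB d) → ∃ (e : Literature.Geometry.Lorentzian.AFEnd X) (F : EuclideanSpace ℝ (Fin 1) → Literature.Geometry.Lorentzian.InitialDataSet (𝓡 3) X), Literature.Geometry.Lorentzian.InitialDataSet.IsTameDataFamily e 1 F ∧ Literature.Geometry.Lorentzian.InitialDataSet.IsImmersedAtZero 1 F ∧ F 0 = d ∧ Injective F ∧ (∀ c, F c ∈ Literature.Geometry.Lorentzian.admissibleVacuumData X) ∧ ∀ c ≠ 0, P (F c)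

-- parent: BoundedSingleExit · child (gen 1)
/--     item stmt-FinalStateConjecture-28424 · crux · rank 203 · open
    parent: BoundedSingleExit · by planner
    why it might fail: Extremal horizons DO form dynamically in finite time for Einstein–Maxwell–charged matter (Kehle–Unger); a vacuum analogue A_f = 8πM_f², or an eternal non-radiating exterior reservoir giving A_f < 8πM_f², is excluded by no theorem (no-periodic results need analyticity/stationarity near 𝓘).
    sources: arXiv:2211.15742, arXiv:2402.10190, arXiv:1504.04592, arXiv:1008.0248
[crux · SPECIAL-TYPE · leaf L of lens-5 g5 on stmt-27603] Same population with Acc ∧ ¬KerrB ∧ HeavyB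
∧ ¬Hor: the books are at or below the extremal Kerr line (AreaF ≤ 8π·MassF²) and NO honest outermost
horizon of area ≥ 16π(0.81)m² is available — the EXTREMAL END STATE corner (A_f = 8πM_f²: dynamical
formation of an extremal vacuum horizon) together with the «massive eternal exterior reservoir»
corner (A_f < 8πM_f² with mass that never radiates nor falls in): exit tamely with codimension ≥ 1.
IDEA-NEEDED: a vacuum third law / no-reservoir theorem (Kehle–Unger arXiv:2211.15742 shows extremal
horizons DO form in finite time for Einstein–Maxwell–charged matter; vacuum open; no-periodic
results arXiv:1504.04592, arXiv:1008.0248 need stationarity/analyticity near 𝓘). Mechanism disjoint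
from K (rate), H (Penrose inequality), N (Bondi account). -/
@[route_item "route-FinalStateConjecture-RootDecompFinalChargeCells"]
def HeavyChargeExit : Prop :=
  ∀ (X : Type) [TopologicalSpace X] [ChartedSpace Literature.Geometry.Lorentzian.E3 X] [IsManifold (𝓡 3) ((⊤ : ℕ∞) : WithTop ℕ∞) X] [T2Space X] [SecondCountableTopology X] [ConnectedSpace X], let P : Literature.Geometry.Lorentzian.InitialDataSet (𝓡 3) X → Prop := fun D ↦ (∃ 𝒟 : Literature.Geometry.Lorentzian.VacuumCauchyDevelopment D, 𝒟.IsMaximal) ∧ ∀ 𝒟 : Literature.Geometry.Lorentzian.VacuumCauchyDevelopment D, 𝒟.IsMaximal → Summit.FinalStateConjecture.HasCompleteNullInfinity 𝒟.toCauchyDevelopment ∧ ∃ (O : Set 𝒟.carrier) (d : Literature.Geometry.Lorentzian.FinalStateDecomposition 𝒟.toSpacetime O 2), (∀ i, Literature.Geometry.Lorentzian.Kerr.IsSubextremal (d.mass i) (d.spin i)) ∧ O = Summit.FinalStateConjecture.exteriorOf 𝒟.toCauchyDevelopment d.charted ∧ Summit.FinalStateConjecture.RaysStayInClosure 𝒟.toCauchyDevelopment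 O ∧ Summit.FinalStateConjecture.HasExhaustiveCharts d ∧ Summit.FinalStateConjecture.IsFutureOriented d; let Pw0 : Literature.Geometry.Lorentzian.InitialDataSet (𝓡 3) X → Prop := fun D ↦ (∃ 𝒟 : Literature.Geometry.Lorentzian.VacuumCauchyDevelopment D, 𝒟.IsMaximal) ∧ ∀ 𝒟 : Literature.Geometry.Lorentzian.VacuumCauchyDevelopment D, 𝒟.IsMaximal → Summit.FinalStateConjecture.HasCompleteNullInfinity 𝒟.toCauchyDevelopment ∧ ∃ (O : Set 𝒟.carrier) (d : Literature.Geometry.Lorentzian.FinalStateDecomposition 𝒟.toSpacetime O 0), O = Summit.FinalStateConjecture.exteriorOf 𝒟.toCauchyDevelopment d.charted ∧ Summit.FinalStateConjecture.RaysStayInClosure 𝒟.toCauchyDevelopment O ∧ Summit.FinalStateConjecture.HasExhaustiveCharts d ∧ Summit.FinalStateConjecture.IsFutureOriented d; let Disp : Literature.Geometry.Lorentzian.InitialDataSet (𝓡 3) X → Prop := fun D ↦ (∃ 𝒟 : Literature.Geometry.Lorentzian.VacuumCauchyDevelopment D, 𝒟.IsMaximal) ∧ ∀ 𝒟 : Literature.Geometry.Lorentzian.VacuumCauchyDevelopment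 D, 𝒟.IsMaximal → ∀ [𝒟.metric.HasLeviCivita], ¬ 𝒟.metric.IsFutureNullGeodesicallyIncomplete 𝒟.timeOrientation ∧ ¬ 𝒟.metric.IsFutureTimelikeGeodesicallyIncomplete 𝒟.timeOrientation; let Trap : Literature.Geometry.Lorentzian.InitialDataSet (𝓡 3) X → Prop := fun D ↦ (∃ 𝒟 : Literature.Geometry.Lorentzian.VacuumCauchyDevelopment D, 𝒟.IsMaximal) ∧ ∀ 𝒟 : Literature.Geometry.Lorentzian.VacuumCauchyDevelopment D, 𝒟.IsMaximal → ∀ [𝒟.metric.HasLeviCivita], ∃ f : Metric.sphere (0 : Literature.Geometry.Lorentzian.E3) 1 → 𝒟.carrier, Set.range f ⊆ 𝒟.metric.causalFuture 𝒟.timeOrientation (Set.range 𝒟.embed) ∧ 𝒟.metric.IsTrappedSurface (𝓡 2) 𝒟.timeOrientation f; let Cens : Literature.Geometry.Lorentzian.InitialDataSet (𝓡 3) X → Prop := fun D ↦ ∀ 𝒟 : Literature.Geometry.Lorentzian.VacuumCauchyDevelopment D, 𝒟.IsMaximal → Summit.FinalStateConjecture.HasCompleteNullInfinity 𝒟.toCauchyDevelopment;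 let Single : Literature.Geometry.Lorentzian.InitialDataSet (𝓡 3) X → Prop := fun D ↦ ∀ 𝒟 : Literature.Geometry.Lorentzian.VacuumCauchyDevelopment D, 𝒟.IsMaximal → ∀ [𝒟.metric.HasLeviCivita], Subsingleton (ConnectedComponents ↥(Literature.Geometry.Lorentzian.DataEmbedding.blackHoleRegion 𝒟.toDataEmbedding ∩ 𝒟.metric.causalFuture 𝒟.timeOrientation (Set.range 𝒟.embed))); let CenFinF : Literature.Geometry.Lorentzian.InitialDataSet (𝓡 3) X → Prop := fun D ↦ ∀ 𝒟 : Literature.Geometry.Lorentzian.VacuumCauchyDevelopment D, 𝒟.IsMaximal → ∃ n : ℕ, ∀ (X' : Type) [TopologicalSpace X'] [ChartedSpace Literature.Geometry.Lorentzian.E3 X'] [IsManifold (𝓡 3) ((⊤ : ℕ∞) : WithTop ℕ∞) X'] [ConnectedSpace X'] (D' : Literature.Geometry.Lorentzian.InitialDataSet (𝓡 3) X') (ι' : X' → 𝒟.carrier) (ν' : Literature.Geometry.Lorentzian.NormalField (𝓡 4) ι'), Manifold.IsSmoothEmbedding (𝓡 3) (𝓡 4) ((⊤ : ℕ∞) :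 WithTop ℕ∞) ι' → 𝒟.metric.IsFutureUnitNormal (𝓡 3) 𝒟.timeOrientation ι' ν' → (∀ y : X', Literature.Geometry.Lorentzian.pullbackBilin (I := 𝓡 4) (I' := 𝓡 3) ι' 𝒟.metric.val y = D'.h.inner y) → (∀ [𝒟.metric.toPseudoRiemannianMetric.HasLeviCivita] (y : X'), 𝒟.metric.toPseudoRiemannianMetric.secondFundamentalForm (𝓡 3) ι' ν' y = D'.kBilin y) → 𝒟.metric.IsCauchyHypersurface 𝒟.timeOrientation (Set.range ι') → Set.range ι' ⊆ 𝒟.metric.causalFuture 𝒟.timeOrientation (Set.range 𝒟.embed) → ∀ S : Fin (n + 1) → Literature.Geometry.Lorentzian.OutermostMOTS (𝓡 3) D'.h D'.k, (∀ j, ConnectedSpace (S j).surf) → (∀ j, IsCompact (((S j).exterior : Set X'))ᶜ ∧ (interior (((S j).exterior : Set X'))ᶜ).Nonempty) → ∃ j j', j ≠ j' ∧ ((((S j).exterior : Set X'))ᶜ ∩ (((S j').exterior : Set X'))ᶜ).Nonempty; let kerrLo : ENNReal → ENNReal := fun M ↦ ENNReal.ofReal (8 * Real.pi) * M ^ 2;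 let kerrHi : ENNReal → ENNReal := fun M ↦ ENNReal.ofReal (16 * Real.pi) * M ^ 2; let MassF : (D : Literature.Geometry.Lorentzian.InitialDataSet (𝓡 3) X) → Literature.Geometry.Lorentzian.VacuumCauchyDevelopment D → ENNReal := fun D 𝒟 ↦ ⨅ (K : Set 𝒟.carrier) (_ : IsCompact K) (m : ℝ) (_ : 𝒟.toCauchyDevelopment.HasCutBondiMass K m), ENNReal.ofReal m; let AreaF : (D : Literature.Geometry.Lorentzian.InitialDataSet (𝓡 3) X) → (𝒟 : Literature.Geometry.Lorentzian.VacuumCauchyDevelopment D) → [𝒟.metric.HasLeviCivita] → ENNReal := fun D 𝒟 hLC ↦ sInf {a : ENNReal | ∀ (X' : Type) [TopologicalSpace X'] [ChartedSpace Literature.Geometry.Lorentzian.E3 X'] [IsManifold (𝓡 3) ((⊤ : ℕ∞) : WithTop ℕ∞) X'] [ConnectedSpace X'] [T2Space X'] (D' : Literature.Geometry.Lorentzian.InitialDataSet (𝓡 3) X') (ι' : X' → 𝒟.carrier) (ν' : Literature.Geometry.Lorentzian.NormalField (𝓡 4) ι'), Manifold.IsSmoothEmbedding (𝓡 3) (𝓡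 4) ((⊤ : ℕ∞) : WithTop ℕ∞) ι' → 𝒟.metric.IsFutureUnitNormal (𝓡 3) 𝒟.timeOrientation ι' ν' → (∀ y : X', Literature.Geometry.Lorentzian.pullbackBilin (I := 𝓡 4) (I' := 𝓡 3) ι' 𝒟.metric.val y = D'.h.inner y) → (∀ [𝒟.metric.toPseudoRiemannianMetric.HasLeviCivita] (y : X'), 𝒟.metric.toPseudoRiemannianMetric.secondFundamentalForm (𝓡 3) ι' ν' y = D'.kBilin y) → 𝒟.metric.IsCauchyHypersurface 𝒟.timeOrientation (Set.range ι') → Set.range ι' ⊆ 𝒟.metric.causalFuture 𝒟.timeOrientation (Set.range 𝒟.embed) → (letI : MeasurableSpace X' := borel X'; haveI : BorelSpace X' := ⟨rfl⟩; haveI : LocallyCompactSpace X' := ChartedSpace.locallyCompactSpace Literature.Geometry.Lorentzian.E3 X'; Literature.Geometry.Lorentzian.area D'.h (ι' ⁻¹' Literature.Geometry.Lorentzian.DataEmbedding.futureEventHorizon 𝒟.toDataEmbedding)) ≤ a}; let Acc : Literature.Geometry.Lorentzian.InitialDataSet (𝓡 3) X → Prop := fun D ↦ ∃ (M A : ENNReal),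 M ≠ ⊤ ∧ (∀ e : Literature.Geometry.Lorentzian.AFEnd X, e.IsAsymptoticallyFlat D 1 → (∃ m, e.HasADMEnergy D m) → M ≤ ENNReal.ofReal (e.admMass D)) ∧ ∀ 𝒟 : Literature.Geometry.Lorentzian.VacuumCauchyDevelopment D, 𝒟.IsMaximal → ∀ [𝒟.metric.HasLeviCivita], MassF D 𝒟 = M ∧ AreaF D 𝒟 = A; let KerrB : Literature.Geometry.Lorentzian.InitialDataSet (𝓡 3) X → Prop := fun D ↦ ∀ 𝒟 : Literature.Geometry.Lorentzian.VacuumCauchyDevelopment D, 𝒟.IsMaximal → ∀ [𝒟.metric.HasLeviCivita], MassF D 𝒟 ≠ ⊤ ∧ kerrLo (MassF D 𝒟) < AreaF D 𝒟 ∧ AreaF D 𝒟 ≤ kerrHi (MassF D 𝒟); let HeavyB : Literature.Geometry.Lorentzian.InitialDataSet (𝓡 3) X → Prop := fun D ↦ ∀ 𝒟 : Literature.Geometry.Lorentzian.VacuumCauchyDevelopment D, 𝒟.IsMaximal → ∀ [𝒟.metric.HasLeviCivita], MassF D 𝒟 ≠ ⊤ ∧ AreaF D 𝒟 ≤ kerrLo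 (MassF D 𝒟); let Hor : Literature.Geometry.Lorentzian.InitialDataSet (𝓡 3) X → Prop := fun D ↦ ∃ (hLC : D.metric.HasLeviCivita) (e : Literature.Geometry.Lorentzian.AFEnd X) (S : Literature.Geometry.Lorentzian.OutermostMOTS (𝓡 3) D.h D.k), haveI : (Literature.Geometry.Lorentzian.PseudoRiemannianMetric.ofRiemannian D.h).HasLeviCivita := hLC; let IsExteriorRegion : TopologicalSpace.Opens X → Prop := fun U ↦ IsConnected (U : Set X) ∧ ∃ R', e.R < R' ∧ e.far R' ⊆ (U : Set X) ∧ IsCompact (closure (U : Set X) \ e.far R'); let IsOutsideOf : TopologicalSpace.Opens X → (S' : Type) → (f' : S' → X) → Literature.Geometry.Lorentzian.NormalField (𝓡 3) f' → Prop := fun U _ f' ν' ↦ frontier (U : Set X) = Set.range f' ∧ (∀ y, ∀ᶠ t in nhdsWithin (0 : ℝ) (Set.Ioi 0), Literature.Geometry.Lorentzian.curveThrough (𝓡 3) (f' y) (ν' y) t ∈ (U : Set X)) ∧ (∀ y, ∀ᶠ t in nhdsWithin (0 : ℝ) (Set.Iio 0), Literature.Geometry.Lorentzian.curveThrough (𝓡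 3) (f' y) (ν' y) t ∉ closure (U : Set X)) ∧ IsExteriorRegion U; let IsCalS : TopologicalSpace.Opens X → Prop := fun V ↦ ∃ (S' : Type) (_ : TopologicalSpace S') (_ : ChartedSpace (EuclideanSpace ℝ (Fin 2)) S') (_ : IsManifold (𝓡 2) ((⊤ : ℕ∞) : WithTop ℕ∞) S') (_ : CompactSpace S') (_ : T2Space S') (f' : S' → X) (ν' : Literature.Geometry.Lorentzian.NormalField (𝓡 3) f'), Manifold.IsSmoothEmbedding (𝓡 2) (𝓡 3) ((⊤ : ℕ∞) : WithTop ℕ∞) f' ∧ (Literature.Geometry.Lorentzian.PseudoRiemannianMetric.ofRiemannian D.h).IsUnitNormal (𝓡 2) f' ν' 1 ∧ IsOutsideOf V S' f' ν'; let WOTFree : TopologicalSpace.Opens X → Prop := fun U ↦ ∀ (S' : Type) [TopologicalSpace S'] [ChartedSpace (EuclideanSpace ℝ (Fin 2)) S'] [IsManifold (𝓡 2) ((⊤ : ℕ∞) : WithTop ℕ∞) S'] [CompactSpace S'] [T2Space S'] (f' : S' → X) (ν' : Literature.Geometry.Lorentzian.NormalField (𝓡 3) f') (hpb' : Literature.Geometry.Lorentzian.PseudoRiemannianMetric.contMDiff_pullbackBilin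 (𝓡 3) X (𝓡 2) S' ((⊤ : ℕ∞) : WithTop ℕ∞)) (hf' : (Literature.Geometry.Lorentzian.PseudoRiemannianMetric.ofRiemannian D.h).IsSpacelikeImmersion (𝓡 2) f') (Ω : TopologicalSpace.Opens X), Manifold.IsSmoothEmbedding (𝓡 2) (𝓡 3) ((⊤ : ℕ∞) : WithTop ℕ∞) f' → Set.range f' ⊆ (U : Set X) → (Literature.Geometry.Lorentzian.PseudoRiemannianMetric.ofRiemannian D.h).IsUnitNormal (𝓡 2) f' ν' 1 → Nonempty S' → frontier (Ω : Set X) = Set.range f' → (∃ R', e.R < R' ∧ Disjoint (e.far R') (Ω : Set X)) → (∀ y, ∀ᶠ t in nhdsWithin (0 : ℝ) (Set.Iio 0), Literature.Geometry.Lorentzian.curveThrough (𝓡 3) (f' y) (ν' y) t ∈ (Ω : Set X)) → ¬ Literature.Geometry.Lorentzian.IsWeaklyOuterTrapped D.h D.k f' hpb' hf' ν'; ContMDiff (𝓡 2) (𝓡 3).tangent ((⊤ : ℕ∞) : WithTop ℕ∞) (fun y ↦ (Bundle.TotalSpace.mk' Literature.Geometry.Lorentzian.E3 (S.f y) (S.ν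 y) : TangentBundle (𝓡 3) X)) ∧ D.SatisfiesDominantEnergyCondition ∧ e.IsAsymptoticallyFlat D 1 ∧ D.IsComplete ∧ (∃ m, e.HasADMEnergy D m) ∧ (∀ i, ∃ p, e.HasADMMomentum D i p) ∧ WOTFree S.exterior ∧ IsOutsideOf S.exterior S.surf S.f S.ν ∧ 0 < e.admMass D ∧ (letI : MeasurableSpace X := borel X; haveI : BorelSpace X := ⟨rfl⟩; haveI : LocallyCompactSpace X := ChartedSpace.locallyCompactSpace Literature.Geometry.Lorentzian.E3 X; (9 / 10 : ℝ) * e.admMass D ≤ Real.sqrt ((⨅ (V : TopologicalSpace.Opens X) (_ : IsCalS V ∧ V ≤ S.exterior), Literature.Geometry.Lorentzian.area D.h (frontier (V : Set X))).toReal / (16 * Real.pi))); ∀ d ∈ Literature.Geometry.Lorentzian.admissibleVacuumData X, ¬ P d → (((¬ Disp d ∧ Trap d ∧ Cens d ∧ ¬ Pw0 d) ∧ Single d) ∧ CenFinF d) → (Acc d ∧ ¬ KerrB d ∧ HeavyB d ∧ ¬ Hor d) → ∃ (e : Literature.Geometry.Lorentzian.AFEnd X) (F : EuclideanSpace ℝ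 (Fin 1) → Literature.Geometry.Lorentzian.InitialDataSet (𝓡 3) X), Literature.Geometry.Lorentzian.InitialDataSet.IsTameDataFamily e 1 F ∧ Literature.Geometry.Lorentzian.InitialDataSet.IsImmersedAtZero 1 F ∧ F 0 = d ∧ Injective F ∧ (∀ c, F c ∈ Literature.Geometry.Lorentzian.admissibleVacuumData X) ∧ ∀ c ≠ 0, P (F c)

-- parent: BoundedSingleExit · child (gen 1)
/--     item stmt-FinalStateConjecture-28425 · crux · rank 204 · open
    parent: BoundedSingleExit · by planner
    why it might fail: M_f ≥ √(A_f/16π) for the LIMITING Bondi mass is Penrose's stronger spacetime statement, proved only near Schwarzschild (Alexakis; Le) or under a quasi-final-state hypothesis (2026); a censored development whose horizon area outgrows 16πM_f² contradicts no theorem.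
    sources: arXiv:1506.06400, arXiv:2605.18730, arXiv:1609.02875, arXiv:2404.17137, arXiv:2505.11399
[crux · IDEA-NEEDED · leaf H of lens-5 g5 on stmt-27603] Same population with Acc ∧ AreaF >
16π·MassF² (the books ABOVE the Schwarzschild line: more final horizon area than any Kerr of the
final Bondi mass can carry): exit tamely with codimension ≥ 1. Conjecturally EMPTY by the
LIMITING-BONDI-MASS (null, late-time) PENROSE INEQUALITY M_f ≥ √(A_f/16π) — Penrose's stronger
spacetime statement, in print only near Schwarzschild (Alexakis arXiv:1506.06400; Le
arXiv:2404.17137; Roesch arXiv:1609.02875) or under a quasi-final-state hypothesis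
(arXiv:2605.18730); print-adjacent idea-leaf, PDE-light relative to K. -/
@[route_item "route-FinalStateConjecture-RootDecompFinalChargeCells"]
def LightChargeExit : Prop :=
  ∀ (X : Type) [TopologicalSpace X] [ChartedSpace Literature.Geometry.Lorentzian.E3 X] [IsManifold (𝓡 3) ((⊤ : ℕ∞) : WithTop ℕ∞) X] [T2Space X] [SecondCountableTopology X] [ConnectedSpace X], let P : Literature.Geometry.Lorentzian.InitialDataSet (𝓡 3) X → Prop := fun D ↦ (∃ 𝒟 : Literature.Geometry.Lorentzian.VacuumCauchyDevelopment D, 𝒟.IsMaximal) ∧ ∀ 𝒟 : Literature.Geometry.Lorentzian.VacuumCauchyDevelopment D, 𝒟.IsMaximal → Summit.FinalStateConjecture.HasCompleteNullInfinity 𝒟.toCauchyDevelopment ∧ ∃ (O : Set 𝒟.carrier) (d : Literature.Geometry.Lorentzian.FinalStateDecomposition 𝒟.toSpacetime O 2), (∀ i, Literature.Geometry.Lorentzian.Kerr.IsSubextremal (d.mass i) (d.spin i)) ∧ O = Summit.FinalStateConjecture.exteriorOf 𝒟.toCauchyDevelopment d.charted ∧ Summit.FinalStateConjecture.RaysStayInClosure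 𝒟.toCauchyDevelopment O ∧ Summit.FinalStateConjecture.HasExhaustiveCharts d ∧ Summit.FinalStateConjecture.IsFutureOriented d; let Pw0 : Literature.Geometry.Lorentzian.InitialDataSet (𝓡 3) X → Prop := fun D ↦ (∃ 𝒟 : Literature.Geometry.Lorentzian.VacuumCauchyDevelopment D, 𝒟.IsMaximal) ∧ ∀ 𝒟 : Literature.Geometry.Lorentzian.VacuumCauchyDevelopment D, 𝒟.IsMaximal → Summit.FinalStateConjecture.HasCompleteNullInfinity 𝒟.toCauchyDevelopment ∧ ∃ (O : Set 𝒟.carrier) (d : Literature.Geometry.Lorentzian.FinalStateDecomposition 𝒟.toSpacetime O 0), O = Summit.FinalStateConjecture.exteriorOf 𝒟.toCauchyDevelopment d.charted ∧ Summit.FinalStateConjecture.RaysStayInClosure 𝒟.toCauchyDevelopment O ∧ Summit.FinalStateConjecture.HasExhaustiveCharts d ∧ Summit.FinalStateConjecture.IsFutureOriented d; let Disp : Literature.Geometry.Lorentzian.InitialDataSet (𝓡 3) X → Prop := fun D ↦ (∃ 𝒟 : Literature.Geometry.Lorentzian.VacuumCauchyDevelopment D, 𝒟.IsMaximal) ∧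 ∀ 𝒟 : Literature.Geometry.Lorentzian.VacuumCauchyDevelopment D, 𝒟.IsMaximal → ∀ [𝒟.metric.HasLeviCivita], ¬ 𝒟.metric.IsFutureNullGeodesicallyIncomplete 𝒟.timeOrientation ∧ ¬ 𝒟.metric.IsFutureTimelikeGeodesicallyIncomplete 𝒟.timeOrientation; let Trap : Literature.Geometry.Lorentzian.InitialDataSet (𝓡 3) X → Prop := fun D ↦ (∃ 𝒟 : Literature.Geometry.Lorentzian.VacuumCauchyDevelopment D, 𝒟.IsMaximal) ∧ ∀ 𝒟 : Literature.Geometry.Lorentzian.VacuumCauchyDevelopment D, 𝒟.IsMaximal → ∀ [𝒟.metric.HasLeviCivita], ∃ f : Metric.sphere (0 : Literature.Geometry.Lorentzian.E3) 1 → 𝒟.carrier, Set.range f ⊆ 𝒟.metric.causalFuture 𝒟.timeOrientation (Set.range 𝒟.embed) ∧ 𝒟.metric.IsTrappedSurface (𝓡 2) 𝒟.timeOrientation f; let Cens : Literature.Geometry.Lorentzian.InitialDataSet (𝓡 3) X → Prop := fun D ↦ ∀ 𝒟 : Literature.Geometry.Lorentzian.VacuumCauchyDevelopment D, 𝒟.IsMaximal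 → Summit.FinalStateConjecture.HasCompleteNullInfinity 𝒟.toCauchyDevelopment; let Single : Literature.Geometry.Lorentzian.InitialDataSet (𝓡 3) X → Prop := fun D ↦ ∀ 𝒟 : Literature.Geometry.Lorentzian.VacuumCauchyDevelopment D, 𝒟.IsMaximal → ∀ [𝒟.metric.HasLeviCivita], Subsingleton (ConnectedComponents ↥(Literature.Geometry.Lorentzian.DataEmbedding.blackHoleRegion 𝒟.toDataEmbedding ∩ 𝒟.metric.causalFuture 𝒟.timeOrientation (Set.range 𝒟.embed))); let CenFinF : Literature.Geometry.Lorentzian.InitialDataSet (𝓡 3) X → Prop := fun D ↦ ∀ 𝒟 : Literature.Geometry.Lorentzian.VacuumCauchyDevelopment D, 𝒟.IsMaximal → ∃ n : ℕ, ∀ (X' : Type) [TopologicalSpace X'] [ChartedSpace Literature.Geometry.Lorentzian.E3 X'] [IsManifold (𝓡 3) ((⊤ : ℕ∞) : WithTop ℕ∞) X'] [ConnectedSpace X'] (D' : Literature.Geometry.Lorentzian.InitialDataSet (𝓡 3) X') (ι' : X' → 𝒟.carrier) (ν' : Literature.Geometry.Lorentzian.NormalField (𝓡 4) ι'), Manifold.IsSmoothEmbedding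 (𝓡 3) (𝓡 4) ((⊤ : ℕ∞) : WithTop ℕ∞) ι' → 𝒟.metric.IsFutureUnitNormal (𝓡 3) 𝒟.timeOrientation ι' ν' → (∀ y : X', Literature.Geometry.Lorentzian.pullbackBilin (I := 𝓡 4) (I' := 𝓡 3) ι' 𝒟.metric.val y = D'.h.inner y) → (∀ [𝒟.metric.toPseudoRiemannianMetric.HasLeviCivita] (y : X'), 𝒟.metric.toPseudoRiemannianMetric.secondFundamentalForm (𝓡 3) ι' ν' y = D'.kBilin y) → 𝒟.metric.IsCauchyHypersurface 𝒟.timeOrientation (Set.range ι') → Set.range ι' ⊆ 𝒟.metric.causalFuture 𝒟.timeOrientation (Set.range 𝒟.embed) → ∀ S : Fin (n + 1) → Literature.Geometry.Lorentzian.OutermostMOTS (𝓡 3) D'.h D'.k, (∀ j, ConnectedSpace (S j).surf) → (∀ j, IsCompact (((S j).exterior : Set X'))ᶜ ∧ (interior (((S j).exterior : Set X'))ᶜ).Nonempty) → ∃ j j', j ≠ j' ∧ ((((S j).exterior : Set X'))ᶜ ∩ (((S j').exterior : Set X'))ᶜ).Nonempty; let kerrLo : ENNReal → ENNReal := fun M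 ↦ ENNReal.ofReal (8 * Real.pi) * M ^ 2; let kerrHi : ENNReal → ENNReal := fun M ↦ ENNReal.ofReal (16 * Real.pi) * M ^ 2; let MassF : (D : Literature.Geometry.Lorentzian.InitialDataSet (𝓡 3) X) → Literature.Geometry.Lorentzian.VacuumCauchyDevelopment D → ENNReal := fun D 𝒟 ↦ ⨅ (K : Set 𝒟.carrier) (_ : IsCompact K) (m : ℝ) (_ : 𝒟.toCauchyDevelopment.HasCutBondiMass K m), ENNReal.ofReal m; let AreaF : (D : Literature.Geometry.Lorentzian.InitialDataSet (𝓡 3) X) → (𝒟 : Literature.Geometry.Lorentzian.VacuumCauchyDevelopment D) → [𝒟.metric.HasLeviCivita] → ENNReal := fun D 𝒟 hLC ↦ sInf {a : ENNReal | ∀ (X' : Type) [TopologicalSpace X'] [ChartedSpace Literature.Geometry.Lorentzian.E3 X'] [IsManifold (𝓡 3) ((⊤ : ℕ∞) : WithTop ℕ∞) X'] [ConnectedSpace X'] [T2Space X'] (D' : Literature.Geometry.Lorentzian.InitialDataSet (𝓡 3) X') (ι' : X' → 𝒟.carrier) (ν' : Literature.Geometry.Lorentzian.NormalField (𝓡 4)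 ι'), Manifold.IsSmoothEmbedding (𝓡 3) (𝓡 4) ((⊤ : ℕ∞) : WithTop ℕ∞) ι' → 𝒟.metric.IsFutureUnitNormal (𝓡 3) 𝒟.timeOrientation ι' ν' → (∀ y : X', Literature.Geometry.Lorentzian.pullbackBilin (I := 𝓡 4) (I' := 𝓡 3) ι' 𝒟.metric.val y = D'.h.inner y) → (∀ [𝒟.metric.toPseudoRiemannianMetric.HasLeviCivita] (y : X'), 𝒟.metric.toPseudoRiemannianMetric.secondFundamentalForm (𝓡 3) ι' ν' y = D'.kBilin y) → 𝒟.metric.IsCauchyHypersurface 𝒟.timeOrientation (Set.range ι') → Set.range ι' ⊆ 𝒟.metric.causalFuture 𝒟.timeOrientation (Set.range 𝒟.embed) → (letI : MeasurableSpace X' := borel X'; haveI : BorelSpace X' := ⟨rfl⟩; haveI : LocallyCompactSpace X' := ChartedSpace.locallyCompactSpace Literature.Geometry.Lorentzian.E3 X'; Literature.Geometry.Lorentzian.area D'.h (ι' ⁻¹' Literature.Geometry.Lorentzian.DataEmbedding.futureEventHorizon 𝒟.toDataEmbedding)) ≤ a}; let Acc : Literature.Geometry.Lorentzian.InitialDataSet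 (𝓡 3) X → Prop := fun D ↦ ∃ (M A : ENNReal), M ≠ ⊤ ∧ (∀ e : Literature.Geometry.Lorentzian.AFEnd X, e.IsAsymptoticallyFlat D 1 → (∃ m, e.HasADMEnergy D m) → M ≤ ENNReal.ofReal (e.admMass D)) ∧ ∀ 𝒟 : Literature.Geometry.Lorentzian.VacuumCauchyDevelopment D, 𝒟.IsMaximal → ∀ [𝒟.metric.HasLeviCivita], MassF D 𝒟 = M ∧ AreaF D 𝒟 = A; let KerrB : Literature.Geometry.Lorentzian.InitialDataSet (𝓡 3) X → Prop := fun D ↦ ∀ 𝒟 : Literature.Geometry.Lorentzian.VacuumCauchyDevelopment D, 𝒟.IsMaximal → ∀ [𝒟.metric.HasLeviCivita], MassF D 𝒟 ≠ ⊤ ∧ kerrLo (MassF D 𝒟) < AreaF D 𝒟 ∧ AreaF D 𝒟 ≤ kerrHi (MassF D 𝒟); let HeavyB : Literature.Geometry.Lorentzian.InitialDataSet (𝓡 3) X → Prop := fun D ↦ ∀ 𝒟 : Literature.Geometry.Lorentzian.VacuumCauchyDevelopment D, 𝒟.IsMaximal → ∀ [𝒟.metric.HasLeviCivita], MassF D 𝒟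 ≠ ⊤ ∧ AreaF D 𝒟 ≤ kerrLo (MassF D 𝒟); ∀ d ∈ Literature.Geometry.Lorentzian.admissibleVacuumData X, ¬ P d → (((¬ Disp d ∧ Trap d ∧ Cens d ∧ ¬ Pw0 d) ∧ Single d) ∧ CenFinF d) → (Acc d ∧ ¬ KerrB d ∧ ¬ HeavyB d) → ∃ (e : Literature.Geometry.Lorentzian.AFEnd X) (F : EuclideanSpace ℝ (Fin 1) → Literature.Geometry.Lorentzian.InitialDataSet (𝓡 3) X), Literature.Geometry.Lorentzian.InitialDataSet.IsTameDataFamily e 1 F ∧ Literature.Geometry.Lorentzian.InitialDataSet.IsImmersedAtZero 1 F ∧ F 0 = d ∧ Injective F ∧ (∀ c, F c ∈ Literature.Geometry.Lorentzian.admissibleVacuumData X) ∧ ∀ c ≠ 0, P (F c)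

-- parent: BoundedSingleExit · child (gen 1)
/--     item stmt-FinalStateConjecture-28426 · crux · rank 205 · open
    parent: BoundedSingleExit · by planner
    why it might fail: That a large censored development carries ANY asymptotically round receding family with a Hawking-mass limit (a Bondi mass at all), MGHD-coherently and ≤ m_ADM in every AF chart, is open: 𝓘⁺ of large data may be too irregular, and Hawking-energy limits depend on the approach to the cut (Mars–Soria).
    sources: arXiv:1506.01545, ChristodoulouKlainerman1993PMS41 Ch.17, Literature/Barriers/FinalStateConjecture/NonSmoothNullInfinity.lean, ChruscielMacCallumSingleton1995
[crux · UNDECIDED · asymptotic-regularity leaf N of lens-5 g5 on stmt-27603] Same population with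
¬Acc: the asymptotic books do NOT close — no asymptotically round receding family with a
Hawking-mass limit MGHD-coherently bounded by m_ADM in every AF chart (no Bondi account at all;
includes every ENNReal junk corner: empty family ⇒ MassF = ⊤): exit tamely with codimension ≥ 1.
Conjecturally EMPTY (large censored developments should possess a Bondi mass with the mass-loss
law), but OPEN for large data: 𝓘⁺ may be too irregular and Hawking-energy limits depend on the
approach to the cut (Mars–Soria arXiv:1506.01545); Bondi mass needs Christodoulou–Klainerman-level
decay, not peeling — adjacent to, but outside, the NonSmoothNullInfinity barrier class (Kehrberger). -/
@[route_item "route-FinalStateConjecture-RootDecompFinalChargeCells"]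
def NoChargeExit : Prop :=
  ∀ (X : Type) [TopologicalSpace X] [ChartedSpace Literature.Geometry.Lorentzian.E3 X] [IsManifold (𝓡 3) ((⊤ : ℕ∞) : WithTop ℕ∞) X] [T2Space X] [SecondCountableTopology X] [ConnectedSpace X], let P : Literature.Geometry.Lorentzian.InitialDataSet (𝓡 3) X → Prop := fun D ↦ (∃ 𝒟 : Literature.Geometry.Lorentzian.VacuumCauchyDevelopment D, 𝒟.IsMaximal) ∧ ∀ 𝒟 : Literature.Geometry.Lorentzian.VacuumCauchyDevelopment D, 𝒟.IsMaximal → Summit.FinalStateConjecture.HasCompleteNullInfinity 𝒟.toCauchyDevelopment ∧ ∃ (O : Set 𝒟.carrier) (d : Literature.Geometry.Lorentzian.FinalStateDecomposition 𝒟.toSpacetime O 2), (∀ i, Literature.Geometry.Lorentzian.Kerr.IsSubextremal (d.mass i) (d.spin i)) ∧ O = Summit.FinalStateConjecture.exteriorOf 𝒟.toCauchyDevelopment d.charted ∧ Summit.FinalStateConjecture.RaysStayInClosure 𝒟.toCauchyDevelopment O ∧ Summit.FinalStateConjecture.HasExhaustiveCharts d ∧ Summit.FinalStateConjecture.IsFutureOriented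 d; let Pw0 : Literature.Geometry.Lorentzian.InitialDataSet (𝓡 3) X → Prop := fun D ↦ (∃ 𝒟 : Literature.Geometry.Lorentzian.VacuumCauchyDevelopment D, 𝒟.IsMaximal) ∧ ∀ 𝒟 : Literature.Geometry.Lorentzian.VacuumCauchyDevelopment D, 𝒟.IsMaximal → Summit.FinalStateConjecture.HasCompleteNullInfinity 𝒟.toCauchyDevelopment ∧ ∃ (O : Set 𝒟.carrier) (d : Literature.Geometry.Lorentzian.FinalStateDecomposition 𝒟.toSpacetime O 0), O = Summit.FinalStateConjecture.exteriorOf 𝒟.toCauchyDevelopment d.charted ∧ Summit.FinalStateConjecture.RaysStayInClosure 𝒟.toCauchyDevelopment O ∧ Summit.FinalStateConjecture.HasExhaustiveCharts d ∧ Summit.FinalStateConjecture.IsFutureOriented d; let Disp : Literature.Geometry.Lorentzian.InitialDataSet (𝓡 3) X → Prop := fun D ↦ (∃ 𝒟 : Literature.Geometry.Lorentzian.VacuumCauchyDevelopment D, 𝒟.IsMaximal) ∧ ∀ 𝒟 : Literature.Geometry.Lorentzian.VacuumCauchyDevelopment D, 𝒟.IsMaximal → ∀ [𝒟.metric.HasLeviCivita],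 ¬ 𝒟.metric.IsFutureNullGeodesicallyIncomplete 𝒟.timeOrientation ∧ ¬ 𝒟.metric.IsFutureTimelikeGeodesicallyIncomplete 𝒟.timeOrientation; let Trap : Literature.Geometry.Lorentzian.InitialDataSet (𝓡 3) X → Prop := fun D ↦ (∃ 𝒟 : Literature.Geometry.Lorentzian.VacuumCauchyDevelopment D, 𝒟.IsMaximal) ∧ ∀ 𝒟 : Literature.Geometry.Lorentzian.VacuumCauchyDevelopment D, 𝒟.IsMaximal → ∀ [𝒟.metric.HasLeviCivita], ∃ f : Metric.sphere (0 : Literature.Geometry.Lorentzian.E3) 1 → 𝒟.carrier, Set.range f ⊆ 𝒟.metric.causalFuture 𝒟.timeOrientation (Set.range 𝒟.embed) ∧ 𝒟.metric.IsTrappedSurface (𝓡 2) 𝒟.timeOrientation f; let Cens : Literature.Geometry.Lorentzian.InitialDataSet (𝓡 3) X → Prop := fun D ↦ ∀ 𝒟 : Literature.Geometry.Lorentzian.VacuumCauchyDevelopment D, 𝒟.IsMaximal → Summit.FinalStateConjecture.HasCompleteNullInfinity 𝒟.toCauchyDevelopment; let Single : Literature.Geometry.Lorentzian.InitialDataSet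 (𝓡 3) X → Prop := fun D ↦ ∀ 𝒟 : Literature.Geometry.Lorentzian.VacuumCauchyDevelopment D, 𝒟.IsMaximal → ∀ [𝒟.metric.HasLeviCivita], Subsingleton (ConnectedComponents ↥(Literature.Geometry.Lorentzian.DataEmbedding.blackHoleRegion 𝒟.toDataEmbedding ∩ 𝒟.metric.causalFuture 𝒟.timeOrientation (Set.range 𝒟.embed))); let CenFinF : Literature.Geometry.Lorentzian.InitialDataSet (𝓡 3) X → Prop := fun D ↦ ∀ 𝒟 : Literature.Geometry.Lorentzian.VacuumCauchyDevelopment D, 𝒟.IsMaximal → ∃ n : ℕ, ∀ (X' : Type) [TopologicalSpace X'] [ChartedSpace Literature.Geometry.Lorentzian.E3 X'] [IsManifold (𝓡 3) ((⊤ : ℕ∞) : WithTop ℕ∞) X'] [ConnectedSpace X'] (D' : Literature.Geometry.Lorentzian.InitialDataSet (𝓡 3) X') (ι' : X' → 𝒟.carrier) (ν' : Literature.Geometry.Lorentzian.NormalField (𝓡 4) ι'), Manifold.IsSmoothEmbedding (𝓡 3) (𝓡 4) ((⊤ : ℕ∞) : WithTop ℕ∞) ι' → 𝒟.metric.IsFutureUnitNormal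 (𝓡 3) 𝒟.timeOrientation ι' ν' → (∀ y : X', Literature.Geometry.Lorentzian.pullbackBilin (I := 𝓡 4) (I' := 𝓡 3) ι' 𝒟.metric.val y = D'.h.inner y) → (∀ [𝒟.metric.toPseudoRiemannianMetric.HasLeviCivita] (y : X'), 𝒟.metric.toPseudoRiemannianMetric.secondFundamentalForm (𝓡 3) ι' ν' y = D'.kBilin y) → 𝒟.metric.IsCauchyHypersurface 𝒟.timeOrientation (Set.range ι') → Set.range ι' ⊆ 𝒟.metric.causalFuture 𝒟.timeOrientation (Set.range 𝒟.embed) → ∀ S : Fin (n + 1) → Literature.Geometry.Lorentzian.OutermostMOTS (𝓡 3) D'.h D'.k, (∀ j, ConnectedSpace (S j).surf) → (∀ j, IsCompact (((S j).exterior : Set X'))ᶜ ∧ (interior (((S j).exterior : Set X'))ᶜ).Nonempty) → ∃ j j', j ≠ j' ∧ ((((S j).exterior : Set X'))ᶜ ∩ (((S j').exterior : Set X'))ᶜ).Nonempty; let MassF : (D : Literature.Geometry.Lorentzian.InitialDataSet (𝓡 3) X) → Literature.Geometry.Lorentzian.VacuumCauchyDevelopment D → ENNReal := fun D 𝒟 ↦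 ⨅ (K : Set 𝒟.carrier) (_ : IsCompact K) (m : ℝ) (_ : 𝒟.toCauchyDevelopment.HasCutBondiMass K m), ENNReal.ofReal m; let AreaF : (D : Literature.Geometry.Lorentzian.InitialDataSet (𝓡 3) X) → (𝒟 : Literature.Geometry.Lorentzian.VacuumCauchyDevelopment D) → [𝒟.metric.HasLeviCivita] → ENNReal := fun D 𝒟 hLC ↦ sInf {a : ENNReal | ∀ (X' : Type) [TopologicalSpace X'] [ChartedSpace Literature.Geometry.Lorentzian.E3 X'] [IsManifold (𝓡 3) ((⊤ : ℕ∞) : WithTop ℕ∞) X'] [ConnectedSpace X'] [T2Space X'] (D' : Literature.Geometry.Lorentzian.InitialDataSet (𝓡 3) X') (ι' : X' → 𝒟.carrier) (ν' : Literature.Geometry.Lorentzian.NormalField (𝓡 4) ι'), Manifold.IsSmoothEmbedding (𝓡 3) (𝓡 4) ((⊤ : ℕ∞) : WithTop ℕ∞) ι' → 𝒟.metric.IsFutureUnitNormal (𝓡 3) 𝒟.timeOrientation ι' ν' → (∀ y : X', Literature.Geometry.Lorentzian.pullbackBilin (I := 𝓡 4) (I' := 𝓡 3) ι' 𝒟.metric.val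 y = D'.h.inner y) → (∀ [𝒟.metric.toPseudoRiemannianMetric.HasLeviCivita] (y : X'), 𝒟.metric.toPseudoRiemannianMetric.secondFundamentalForm (𝓡 3) ι' ν' y = D'.kBilin y) → 𝒟.metric.IsCauchyHypersurface 𝒟.timeOrientation (Set.range ι') → Set.range ι' ⊆ 𝒟.metric.causalFuture 𝒟.timeOrientation (Set.range 𝒟.embed) → (letI : MeasurableSpace X' := borel X'; haveI : BorelSpace X' := ⟨rfl⟩; haveI : LocallyCompactSpace X' := ChartedSpace.locallyCompactSpace Literature.Geometry.Lorentzian.E3 X'; Literature.Geometry.Lorentzian.area D'.h (ι' ⁻¹' Literature.Geometry.Lorentzian.DataEmbedding.futureEventHorizon 𝒟.toDataEmbedding)) ≤ a}; let Acc : Literature.Geometry.Lorentzian.InitialDataSet (𝓡 3) X → Prop := fun D ↦ ∃ (M A : ENNReal), M ≠ ⊤ ∧ (∀ e : Literature.Geometry.Lorentzian.AFEnd X, e.IsAsymptoticallyFlat D 1 → (∃ m, e.HasADMEnergy D m) → M ≤ ENNReal.ofReal (e.admMass D)) ∧ ∀ 𝒟 : Literature.Geometry.Lorentzian.VacuumCauchyDevelopment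 D, 𝒟.IsMaximal → ∀ [𝒟.metric.HasLeviCivita], MassF D 𝒟 = M ∧ AreaF D 𝒟 = A; ∀ d ∈ Literature.Geometry.Lorentzian.admissibleVacuumData X, ¬ P d → (((¬ Disp d ∧ Trap d ∧ Cens d ∧ ¬ Pw0 d) ∧ Single d) ∧ CenFinF d) → ¬ Acc d → ∃ (e : Literature.Geometry.Lorentzian.AFEnd X) (F : EuclideanSpace ℝ (Fin 1) → Literature.Geometry.Lorentzian.InitialDataSet (𝓡 3) X), Literature.Geometry.Lorentzian.InitialDataSet.IsTameDataFamily e 1 F ∧ Literature.Geometry.Lorentzian.InitialDataSet.IsImmersedAtZero 1 F ∧ F 0 = d ∧ Injective F ∧ (∀ c, F c ∈ Literature.Geometry.Lorentzian.admissibleVacuumData X) ∧ ∀ c ≠ 0, P (F c)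

-- parent: BoundedSingleExit · child (gen 1)
/--     item stmt-FinalStateConjecture-28423 · support · rank 202 · open
    parent: BoundedSingleExit · by planner
    why it might fail: Empty only modulo HorizonAreaBridge: should the outermost trapped region of some censored MGHD be visible from 𝓘⁺ in the sojourn formalism (HE 9.2.8 / Wald 12.2.4 porting fails without future causal simplicity) or A_min exceed the Lipschitz horizon-cut area, heavy books could coexist with Hor.
    sources: HawkingEllis1973 §9.2, Wald1984 §12.2, arXiv:2605.18730 p.3, ChruscielEtAl2001 §3-4, decomp-fsc-lens-5/g5/FinalChargeCells.lean:heavyChargeDoor_of_bridge, stmt-FinalStateConjecture-26560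
[support · THIN · EMPTY BY BRIDGE · door Dr of lens-5 g5 on stmt-27603] Same population with Acc ∧
¬KerrB ∧ HeavyB (AreaF ≤ 8π·MassF²) ∧ Hor (lens-1 horizon let of stmt-26560 verbatim: an honest
outermost future horizon with A_min ≥ 16π(0.81)m²): exit tamely with codimension ≥ 1. Conjecturally
EMPTY: lens kernel theorem heavyChargeDoor_of_bridge : HorizonAreaBridge → HeavyChargeDoor (rc 0,
axioms std) by the chain 16π(0.81)m² ≤ A_min ≤ A_f ≤ 8πM_f² ≤ 8πm², 12.96 > 8 — pure arithmetic once
the PDE-free bridge HorizonAreaBridge (A_min ≤ AreaF: invisibility of the outermost trapped body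
from the complete-ray region, HawkingEllis1973 Prop. 9.2.8 / Wald1984 Props. 12.2.2–12.2.4; far AF
region visible; Lipschitz GMT enclosure comparison ChruscielEtAl2001 §3–4) is ported; the bridge
does not fit this route's item cap and is queued as porting request D5 «HorizonAreaBridge»
(statement = lens one-liner verbatim; facts F1–F3) — REGISTERED KILL PATH: a prover lands
«HorizonAreaBridge → HeavyChargeDoor» verbatim from decomp-fsc-lens-5/g5/FinalChargeCells.lean with
--supports this item. Independently dominated by stmt-26560 HorizonDominatedResidual by restriction
(same exit currency; informs len -/
@[route_item "route-FinalStateConjecture-RootDecompFinalChargeCells"]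
def HeavyChargeDoor : Prop :=
  ∀ (X : Type) [TopologicalSpace X] [ChartedSpace Literature.Geometry.Lorentzian.E3 X] [IsManifold (𝓡 3) ((⊤ : ℕ∞) : WithTop ℕ∞) X] [T2Space X] [SecondCountableTopology X] [ConnectedSpace X], let P : Literature.Geometry.Lorentzian.InitialDataSet (𝓡 3) X → Prop := fun D ↦ (∃ 𝒟 : Literature.Geometry.Lorentzian.VacuumCauchyDevelopment D, 𝒟.IsMaximal) ∧ ∀ 𝒟 : Literature.Geometry.Lorentzian.VacuumCauchyDevelopment D, 𝒟.IsMaximal → Summit.FinalStateConjecture.HasCompleteNullInfinity 𝒟.toCauchyDevelopment ∧ ∃ (O : Set 𝒟.carrier) (d : Literature.Geometry.Lorentzian.FinalStateDecomposition 𝒟.toSpacetime O 2), (∀ i, Literature.Geometry.Lorentzian.Kerr.IsSubextremal (d.mass i) (d.spin i)) ∧ O = Summit.FinalStateConjecture.exteriorOf 𝒟.toCauchyDevelopment d.charted ∧ Summit.FinalStateConjecture.RaysStayInClosure 𝒟.toCauchyDevelopment O ∧ Summit.FinalStateConjecture.HasExhaustiveCharts d ∧ Summit.FinalStateConjecture.IsFutureOriented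 d; let Pw0 : Literature.Geometry.Lorentzian.InitialDataSet (𝓡 3) X → Prop := fun D ↦ (∃ 𝒟 : Literature.Geometry.Lorentzian.VacuumCauchyDevelopment D, 𝒟.IsMaximal) ∧ ∀ 𝒟 : Literature.Geometry.Lorentzian.VacuumCauchyDevelopment D, 𝒟.IsMaximal → Summit.FinalStateConjecture.HasCompleteNullInfinity 𝒟.toCauchyDevelopment ∧ ∃ (O : Set 𝒟.carrier) (d : Literature.Geometry.Lorentzian.FinalStateDecomposition 𝒟.toSpacetime O 0), O = Summit.FinalStateConjecture.exteriorOf 𝒟.toCauchyDevelopment d.charted ∧ Summit.FinalStateConjecture.RaysStayInClosure 𝒟.toCauchyDevelopment O ∧ Summit.FinalStateConjecture.HasExhaustiveCharts d ∧ Summit.FinalStateConjecture.IsFutureOriented d; let Disp : Literature.Geometry.Lorentzian.InitialDataSet (𝓡 3) X → Prop := fun D ↦ (∃ 𝒟 : Literature.Geometry.Lorentzian.VacuumCauchyDevelopment D, 𝒟.IsMaximal) ∧ ∀ 𝒟 : Literature.Geometry.Lorentzian.VacuumCauchyDevelopment D, 𝒟.IsMaximal → ∀ [𝒟.metric.HasLeviCivita],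 ¬ 𝒟.metric.IsFutureNullGeodesicallyIncomplete 𝒟.timeOrientation ∧ ¬ 𝒟.metric.IsFutureTimelikeGeodesicallyIncomplete 𝒟.timeOrientation; let Trap : Literature.Geometry.Lorentzian.InitialDataSet (𝓡 3) X → Prop := fun D ↦ (∃ 𝒟 : Literature.Geometry.Lorentzian.VacuumCauchyDevelopment D, 𝒟.IsMaximal) ∧ ∀ 𝒟 : Literature.Geometry.Lorentzian.VacuumCauchyDevelopment D, 𝒟.IsMaximal → ∀ [𝒟.metric.HasLeviCivita], ∃ f : Metric.sphere (0 : Literature.Geometry.Lorentzian.E3) 1 → 𝒟.carrier, Set.range f ⊆ 𝒟.metric.causalFuture 𝒟.timeOrientation (Set.range 𝒟.embed) ∧ 𝒟.metric.IsTrappedSurface (𝓡 2) 𝒟.timeOrientation f; let Cens : Literature.Geometry.Lorentzian.InitialDataSet (𝓡 3) X → Prop := fun D ↦ ∀ 𝒟 : Literature.Geometry.Lorentzian.VacuumCauchyDevelopment D, 𝒟.IsMaximal → Summit.FinalStateConjecture.HasCompleteNullInfinity 𝒟.toCauchyDevelopment; let Single : Literature.Geometry.Lorentzian.InitialDataSet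 (𝓡 3) X → Prop := fun D ↦ ∀ 𝒟 : Literature.Geometry.Lorentzian.VacuumCauchyDevelopment D, 𝒟.IsMaximal → ∀ [𝒟.metric.HasLeviCivita], Subsingleton (ConnectedComponents ↥(Literature.Geometry.Lorentzian.DataEmbedding.blackHoleRegion 𝒟.toDataEmbedding ∩ 𝒟.metric.causalFuture 𝒟.timeOrientation (Set.range 𝒟.embed))); let CenFinF : Literature.Geometry.Lorentzian.InitialDataSet (𝓡 3) X → Prop := fun D ↦ ∀ 𝒟 : Literature.Geometry.Lorentzian.VacuumCauchyDevelopment D, 𝒟.IsMaximal → ∃ n : ℕ, ∀ (X' : Type) [TopologicalSpace X'] [ChartedSpace Literature.Geometry.Lorentzian.E3 X'] [IsManifold (𝓡 3) ((⊤ : ℕ∞) : WithTop ℕ∞) X'] [ConnectedSpace X'] (D' : Literature.Geometry.Lorentzian.InitialDataSet (𝓡 3) X') (ι' : X' → 𝒟.carrier) (ν' : Literature.Geometry.Lorentzian.NormalField (𝓡 4) ι'), Manifold.IsSmoothEmbedding (𝓡 3) (𝓡 4) ((⊤ : ℕ∞) : WithTop ℕ∞) ι' → 𝒟.metric.IsFutureUnitNormal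 (𝓡 3) 𝒟.timeOrientation ι' ν' → (∀ y : X', Literature.Geometry.Lorentzian.pullbackBilin (I := 𝓡 4) (I' := 𝓡 3) ι' 𝒟.metric.val y = D'.h.inner y) → (∀ [𝒟.metric.toPseudoRiemannianMetric.HasLeviCivita] (y : X'), 𝒟.metric.toPseudoRiemannianMetric.secondFundamentalForm (𝓡 3) ι' ν' y = D'.kBilin y) → 𝒟.metric.IsCauchyHypersurface 𝒟.timeOrientation (Set.range ι') → Set.range ι' ⊆ 𝒟.metric.causalFuture 𝒟.timeOrientation (Set.range 𝒟.embed) → ∀ S : Fin (n + 1) → Literature.Geometry.Lorentzian.OutermostMOTS (𝓡 3) D'.h D'.k, (∀ j, ConnectedSpace (S j).surf) → (∀ j, IsCompact (((S j).exterior : Set X'))ᶜ ∧ (interior (((S j).exterior : Set X'))ᶜ).Nonempty) → ∃ j j', j ≠ j' ∧ ((((S j).exterior : Set X'))ᶜ ∩ (((S j').exterior : Set X'))ᶜ).Nonempty; let kerrLo : ENNReal → ENNReal := fun M ↦ ENNReal.ofReal (8 * Real.pi) * M ^ 2; let kerrHi : ENNReal → ENNReal := fun M ↦ ENNReal.ofReal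 (16 * Real.pi) * M ^ 2; let MassF : (D : Literature.Geometry.Lorentzian.InitialDataSet (𝓡 3) X) → Literature.Geometry.Lorentzian.VacuumCauchyDevelopment D → ENNReal := fun D 𝒟 ↦ ⨅ (K : Set 𝒟.carrier) (_ : IsCompact K) (m : ℝ) (_ : 𝒟.toCauchyDevelopment.HasCutBondiMass K m), ENNReal.ofReal m; let AreaF : (D : Literature.Geometry.Lorentzian.InitialDataSet (𝓡 3) X) → (𝒟 : Literature.Geometry.Lorentzian.VacuumCauchyDevelopment D) → [𝒟.metric.HasLeviCivita] → ENNReal := fun D 𝒟 hLC ↦ sInf {a : ENNReal | ∀ (X' : Type) [TopologicalSpace X'] [ChartedSpace Literature.Geometry.Lorentzian.E3 X'] [IsManifold (𝓡 3) ((⊤ : ℕ∞) : WithTop ℕ∞) X'] [ConnectedSpace X'] [T2Space X'] (D' : Literature.Geometry.Lorentzian.InitialDataSet (𝓡 3) X') (ι' : X' → 𝒟.carrier) (ν' : Literature.Geometry.Lorentzian.NormalField (𝓡 4) ι'), Manifold.IsSmoothEmbedding (𝓡 3) (𝓡 4) ((⊤ : ℕ∞) : WithTop ℕ∞) ι' →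 𝒟.metric.IsFutureUnitNormal (𝓡 3) 𝒟.timeOrientation ι' ν' → (∀ y : X', Literature.Geometry.Lorentzian.pullbackBilin (I := 𝓡 4) (I' := 𝓡 3) ι' 𝒟.metric.val y = D'.h.inner y) → (∀ [𝒟.metric.toPseudoRiemannianMetric.HasLeviCivita] (y : X'), 𝒟.metric.toPseudoRiemannianMetric.secondFundamentalForm (𝓡 3) ι' ν' y = D'.kBilin y) → 𝒟.metric.IsCauchyHypersurface 𝒟.timeOrientation (Set.range ι') → Set.range ι' ⊆ 𝒟.metric.causalFuture 𝒟.timeOrientation (Set.range 𝒟.embed) → (letI : MeasurableSpace X' := borel X'; haveI : BorelSpace X' := ⟨rfl⟩; haveI : LocallyCompactSpace X' := ChartedSpace.locallyCompactSpace Literature.Geometry.Lorentzian.E3 X'; Literature.Geometry.Lorentzian.area D'.h (ι' ⁻¹' Literature.Geometry.Lorentzian.DataEmbedding.futureEventHorizon 𝒟.toDataEmbedding)) ≤ a}; let Acc : Literature.Geometry.Lorentzian.InitialDataSet (𝓡 3) X → Prop := fun D ↦ ∃ (M A : ENNReal), M ≠ ⊤ ∧ (∀ e : Literature.Geometry.Lorentzian.AFEnd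 X, e.IsAsymptoticallyFlat D 1 → (∃ m, e.HasADMEnergy D m) → M ≤ ENNReal.ofReal (e.admMass D)) ∧ ∀ 𝒟 : Literature.Geometry.Lorentzian.VacuumCauchyDevelopment D, 𝒟.IsMaximal → ∀ [𝒟.metric.HasLeviCivita], MassF D 𝒟 = M ∧ AreaF D 𝒟 = A; let KerrB : Literature.Geometry.Lorentzian.InitialDataSet (𝓡 3) X → Prop := fun D ↦ ∀ 𝒟 : Literature.Geometry.Lorentzian.VacuumCauchyDevelopment D, 𝒟.IsMaximal → ∀ [𝒟.metric.HasLeviCivita], MassF D 𝒟 ≠ ⊤ ∧ kerrLo (MassF D 𝒟) < AreaF D 𝒟 ∧ AreaF D 𝒟 ≤ kerrHi (MassF D 𝒟); let HeavyB : Literature.Geometry.Lorentzian.InitialDataSet (𝓡 3) X → Prop := fun D ↦ ∀ 𝒟 : Literature.Geometry.Lorentzian.VacuumCauchyDevelopment D, 𝒟.IsMaximal → ∀ [𝒟.metric.HasLeviCivita], MassF D 𝒟 ≠ ⊤ ∧ AreaF D 𝒟 ≤ kerrLo (MassF D 𝒟); let Hor : Literature.Geometry.Lorentzian.InitialDataSet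 (𝓡 3) X → Prop := fun D ↦ ∃ (hLC : D.metric.HasLeviCivita) (e : Literature.Geometry.Lorentzian.AFEnd X) (S : Literature.Geometry.Lorentzian.OutermostMOTS (𝓡 3) D.h D.k), haveI : (Literature.Geometry.Lorentzian.PseudoRiemannianMetric.ofRiemannian D.h).HasLeviCivita := hLC; let IsExteriorRegion : TopologicalSpace.Opens X → Prop := fun U ↦ IsConnected (U : Set X) ∧ ∃ R', e.R < R' ∧ e.far R' ⊆ (U : Set X) ∧ IsCompact (closure (U : Set X) \ e.far R'); let IsOutsideOf : TopologicalSpace.Opens X → (S' : Type) → (f' : S' → X) → Literature.Geometry.Lorentzian.NormalField (𝓡 3) f' → Prop := fun U _ f' ν' ↦ frontier (U : Set X) = Set.range f' ∧ (∀ y, ∀ᶠ t in nhdsWithin (0 : ℝ) (Set.Ioi 0), Literature.Geometry.Lorentzian.curveThrough (𝓡 3) (f' y) (ν' y) t ∈ (U : Set X)) ∧ (∀ y, ∀ᶠ t in nhdsWithin (0 : ℝ) (Set.Iio 0), Literature.Geometry.Lorentzian.curveThrough (𝓡 3) (f' y) (ν' y) t ∉ closure (U : Set X)) ∧ IsExteriorRegion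 U; let IsCalS : TopologicalSpace.Opens X → Prop := fun V ↦ ∃ (S' : Type) (_ : TopologicalSpace S') (_ : ChartedSpace (EuclideanSpace ℝ (Fin 2)) S') (_ : IsManifold (𝓡 2) ((⊤ : ℕ∞) : WithTop ℕ∞) S') (_ : CompactSpace S') (_ : T2Space S') (f' : S' → X) (ν' : Literature.Geometry.Lorentzian.NormalField (𝓡 3) f'), Manifold.IsSmoothEmbedding (𝓡 2) (𝓡 3) ((⊤ : ℕ∞) : WithTop ℕ∞) f' ∧ (Literature.Geometry.Lorentzian.PseudoRiemannianMetric.ofRiemannian D.h).IsUnitNormal (𝓡 2) f' ν' 1 ∧ IsOutsideOf V S' f' ν'; let WOTFree : TopologicalSpace.Opens X → Prop := fun U ↦ ∀ (S' : Type) [TopologicalSpace S'] [ChartedSpace (EuclideanSpace ℝ (Fin 2)) S'] [IsManifold (𝓡 2) ((⊤ : ℕ∞) : WithTop ℕ∞) S'] [CompactSpace S'] [T2Space S'] (f' : S' → X) (ν' : Literature.Geometry.Lorentzian.NormalField (𝓡 3) f') (hpb' : Literature.Geometry.Lorentzian.PseudoRiemannianMetric.contMDiff_pullbackBilin (𝓡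 3) X (𝓡 2) S' ((⊤ : ℕ∞) : WithTop ℕ∞)) (hf' : (Literature.Geometry.Lorentzian.PseudoRiemannianMetric.ofRiemannian D.h).IsSpacelikeImmersion (𝓡 2) f') (Ω : TopologicalSpace.Opens X), Manifold.IsSmoothEmbedding (𝓡 2) (𝓡 3) ((⊤ : ℕ∞) : WithTop ℕ∞) f' → Set.range f' ⊆ (U : Set X) → (Literature.Geometry.Lorentzian.PseudoRiemannianMetric.ofRiemannian D.h).IsUnitNormal (𝓡 2) f' ν' 1 → Nonempty S' → frontier (Ω : Set X) = Set.range f' → (∃ R', e.R < R' ∧ Disjoint (e.far R') (Ω : Set X)) → (∀ y, ∀ᶠ t in nhdsWithin (0 : ℝ) (Set.Iio 0), Literature.Geometry.Lorentzian.curveThrough (𝓡 3) (f' y) (ν' y) t ∈ (Ω : Set X)) → ¬ Literature.Geometry.Lorentzian.IsWeaklyOuterTrapped D.h D.k f' hpb' hf' ν'; ContMDiff (𝓡 2) (𝓡 3).tangent ((⊤ : ℕ∞) : WithTop ℕ∞) (fun y ↦ (Bundle.TotalSpace.mk' Literature.Geometry.Lorentzian.E3 (S.f y) (S.ν y) : TangentBundle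 (𝓡 3) X)) ∧ D.SatisfiesDominantEnergyCondition ∧ e.IsAsymptoticallyFlat D 1 ∧ D.IsComplete ∧ (∃ m, e.HasADMEnergy D m) ∧ (∀ i, ∃ p, e.HasADMMomentum D i p) ∧ WOTFree S.exterior ∧ IsOutsideOf S.exterior S.surf S.f S.ν ∧ 0 < e.admMass D ∧ (letI : MeasurableSpace X := borel X; haveI : BorelSpace X := ⟨rfl⟩; haveI : LocallyCompactSpace X := ChartedSpace.locallyCompactSpace Literature.Geometry.Lorentzian.E3 X; (9 / 10 : ℝ) * e.admMass D ≤ Real.sqrt ((⨅ (V : TopologicalSpace.Opens X) (_ : IsCalS V ∧ V ≤ S.exterior), Literature.Geometry.Lorentzian.area D.h (frontier (V : Set X))).toReal / (16 * Real.pi))); ∀ d ∈ Literature.Geometry.Lorentzian.admissibleVacuumData X, ¬ P d → (((¬ Disp d ∧ Trap d ∧ Cens d ∧ ¬ Pw0 d) ∧ Single d) ∧ CenFinF d) → (Acc d ∧ ¬ KerrB d ∧ HeavyB d ∧ Hor d) → ∃ (e : Literature.Geometry.Lorentzian.AFEnd X) (F : EuclideanSpace ℝ (Fin 1) → Literature.Geometry.Lorentzian.InitialDataSet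 (𝓡 3) X), Literature.Geometry.Lorentzian.InitialDataSet.IsTameDataFamily e 1 F ∧ Literature.Geometry.Lorentzian.InitialDataSet.IsImmersedAtZero 1 F ∧ F 0 = d ∧ Injective F ∧ (∀ c, F c ∈ Literature.Geometry.Lorentzian.admissibleVacuumData X) ∧ ∀ c ≠ 0, P (F c)

-- parent: BoundedSingleExit · glue (gen 1)
/--     item stmt-FinalStateConjecture-28427 · support · rank 206 · closed · proved by Summit.FinalStateConjecture.FinalStateConjecture.Theorems.RootDecompFinalChargeCellsBoundedSingleExitGlue.boundedSingleExitGlue (prover)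
    parent: BoundedSingleExit · GLUE: children ⟹ parent · by planner
SubextremalChargeExit → HeavyChargeDoor → HeavyChargeExit → LightChargeExit → NoChargeExit →
BoundedSingleExit -/
@[route_item "route-FinalStateConjecture-RootDecompFinalChargeCells"]
def BoundedSingleExitGlue : Prop :=
  SubextremalChargeExit → HeavyChargeDoor → HeavyChargeExit → LightChargeExit → NoChargeExit → BoundedSingleExit

-- `BoundedSingleExitGlue` holds: proved by `Summit.FinalStateConjecture.FinalStateConjecture.Theorems.RootDecompFinalChargeCellsBoundedSingleExitGlue.boundedSingleExitGlue` (its module imports this route file, so no `_holds` link can be stated here).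

/-- item stmt-FinalStateConjecture-26646 · crux · rank 3 · open · by planner
why it might fail: A tame-open set of admissible data whose MGHD keeps two holes on an eternal quasi-periodic censored orbit (a vacuum 'floating' binary), or n ≥ 3 co-axial multi-Kerr(–NUT) equilibria that exist AND are attained from an open set, would refute it; n ≥ 3 non-existence is open (CCH12 p.14).
sources: doi:10.1007/BF00770326, arXiv:0905.4179, arXiv:1103.5248, arXiv:1105.5830, arXiv:1111.1448, arXiv:0811.1727
[crux · child 𝓣₂² of TrappedCaptureExit · SPECIAL-TYPE (configurational) · INSTRUMENTABLE; CLEARED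
by decomp-fsc-crit-1-g0 2026-08-30T03:23:32Z (k = 3 chosen); writer glue/exactness
folder/n2bg3/Sketch.lean rc 0 / 0 sorry.] For every Σ and every admissible P_Σ-exceptional datum d
of the capture cell 𝓣₂ (not of dispersive type; every MGHD contains a closed trapped sphere in the
causal future of the data; every MGHD has complete future null infinity; d fails the weak C⁰
property P_w⁰) SOME of whose MGHDs ends with AT LEAST TWO black holes (𝓑⁺ not preconnected) and ALL
of whose MGHDs end with FINITELY MANY (Finite (ConnectedComponents ↥𝓑⁺)), there are one end e and a
tame (order 1 at e), immersed-at-0, injective one-parameter family F of admissible data with F 0 = d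
all of whose members c ≠ 0 satisfy P_Σ. Content = the generic MANY-BODY sector of the capture
problem: (i) no eternal non-merging bound binary with censored exterior (radiative dissipation),
(ii) no stationary n-horizon vacuum equilibrium to park at (static: Bunting–Masood-ul-Alam 1987,
Beig–Gibbons–Schoen 2009; n = 2 stationary: Neugebauer–Hennig + Chruściel et al., CCH12 Thm 3.6; n ≥
3 widely open), (iii) capture of each -/
@[route_item "route-FinalStateConjecture-RootDecompFinalChargeCells", crux]
def MultiHoleCaptureExit : Prop :=
  ∀ (X : Type) [TopologicalSpace X] [ChartedSpace Literature.Geometry.Lorentzian.E3 X] [IsManifold (𝓡 3) ((⊤ : ℕ∞) : WithTop ℕ∞) X] [T2Space X] [SecondCountableTopology X] [ConnectedSpace X], let P : Literature.Geometry.Lorentzian.InitialDataSet (𝓡 3) X → Prop := fun D ↦ (∃ 𝒟 : Literature.Geometry.Lorentzian.VacuumCauchyDevelopment D, 𝒟.IsMaximal) ∧ ∀ 𝒟 : Literature.Geometry.Lorentzian.VacuumCauchyDevelopment D, 𝒟.IsMaximal → Summit.FinalStateConjecture.HasCompleteNullInfinity 𝒟.toCauchyDevelopment ∧ ∃ (O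 : Set 𝒟.carrier) (d : Literature.Geometry.Lorentzian.FinalStateDecomposition 𝒟.toSpacetime O 2), (∀ i, Literature.Geometry.Lorentzian.Kerr.IsSubextremal (d.mass i) (d.spin i)) ∧ O = Summit.FinalStateConjecture.exteriorOf 𝒟.toCauchyDevelopment d.charted ∧ Summit.FinalStateConjecture.RaysStayInClosure 𝒟.toCauchyDevelopment O ∧ Summit.FinalStateConjecture.HasExhaustiveCharts d ∧ Summit.FinalStateConjecture.IsFutureOriented d; let Pw0 : Literature.Geometry.Lorentzian.InitialDataSet (𝓡 3) X → Prop := fun D ↦ (∃ 𝒟 : Literature.Geometry.Lorentzian.VacuumCauchyDevelopment D, 𝒟.IsMaximal) ∧ ∀ 𝒟 : Literature.Geometry.Lorentzian.VacuumCauchyDevelopment D, 𝒟.IsMaximal → Summit.FinalStateConjecture.HasCompleteNullInfinity 𝒟.toCauchyDevelopment ∧ ∃ (O : Set 𝒟.carrier) (d : Literature.Geometry.Lorentzian.FinalStateDecomposition 𝒟.toSpacetime O 0), O = Summit.FinalStateConjecture.exteriorOf 𝒟.toCauchyDevelopment d.charted ∧ Summit.FinalStateConjecture.RaysStayInClosure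 𝒟.toCauchyDevelopment O ∧ Summit.FinalStateConjecture.HasExhaustiveCharts d ∧ Summit.FinalStateConjecture.IsFutureOriented d; let Disp : Literature.Geometry.Lorentzian.InitialDataSet (𝓡 3) X → Prop := fun D ↦ (∃ 𝒟 : Literature.Geometry.Lorentzian.VacuumCauchyDevelopment D, 𝒟.IsMaximal) ∧ ∀ 𝒟 : Literature.Geometry.Lorentzian.VacuumCauchyDevelopment D, 𝒟.IsMaximal → ∀ [𝒟.metric.HasLeviCivita], ¬ 𝒟.metric.IsFutureNullGeodesicallyIncomplete 𝒟.timeOrientation ∧ ¬ 𝒟.metric.IsFutureTimelikeGeodesicallyIncomplete 𝒟.timeOrientation; let Trap : Literature.Geometry.Lorentzian.InitialDataSet (𝓡 3) X → Prop := fun D ↦ (∃ 𝒟 : Literature.Geometry.Lorentzian.VacuumCauchyDevelopment D, 𝒟.IsMaximal) ∧ ∀ 𝒟 : Literature.Geometry.Lorentzian.VacuumCauchyDevelopment D, 𝒟.IsMaximal → ∀ [𝒟.metric.HasLeviCivita], ∃ f : Metric.sphere (0 : Literature.Geometry.Lorentzian.E3) 1 → 𝒟.carrier, Set.range f ⊆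 𝒟.metric.causalFuture 𝒟.timeOrientation (Set.range 𝒟.embed) ∧ 𝒟.metric.IsTrappedSurface (𝓡 2) 𝒟.timeOrientation f; let Cens : Literature.Geometry.Lorentzian.InitialDataSet (𝓡 3) X → Prop := fun D ↦ ∀ 𝒟 : Literature.Geometry.Lorentzian.VacuumCauchyDevelopment D, 𝒟.IsMaximal → Summit.FinalStateConjecture.HasCompleteNullInfinity 𝒟.toCauchyDevelopment; let Single : Literature.Geometry.Lorentzian.InitialDataSet (𝓡 3) X → Prop := fun D ↦ ∀ 𝒟 : Literature.Geometry.Lorentzian.VacuumCauchyDevelopment D, 𝒟.IsMaximal → ∀ [𝒟.metric.HasLeviCivita], Subsingleton (ConnectedComponents ↥(Literature.Geometry.Lorentzian.DataEmbedding.blackHoleRegion 𝒟.toDataEmbedding ∩ 𝒟.metric.causalFuture 𝒟.timeOrientation (Set.range 𝒟.embed))); let FinMany : Literature.Geometry.Lorentzian.InitialDataSet (𝓡 3) X → Prop := fun D ↦ ∀ 𝒟 : Literature.Geometry.Lorentzian.VacuumCauchyDevelopment D, 𝒟.IsMaximal → ∀ [𝒟.metric.HasLeviCivita], Finite (ConnectedComponents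 ↥(Literature.Geometry.Lorentzian.DataEmbedding.blackHoleRegion 𝒟.toDataEmbedding ∩ 𝒟.metric.causalFuture 𝒟.timeOrientation (Set.range 𝒟.embed))); ∀ d ∈ Literature.Geometry.Lorentzian.admissibleVacuumData X, ¬ P d → ((¬ Disp d ∧ Trap d ∧ Cens d ∧ ¬ Pw0 d) ∧ ¬ Single d ∧ FinMany d) → ∃ (e : Literature.Geometry.Lorentzian.AFEnd X) (F : EuclideanSpace ℝ (Fin 1) → Literature.Geometry.Lorentzian.InitialDataSet (𝓡 3) X), Literature.Geometry.Lorentzian.InitialDataSet.IsTameDataFamily e 1 F ∧ Literature.Geometry.Lorentzian.InitialDataSet.IsImmersedAtZero 1 F ∧ F 0 = d ∧ Injective F ∧ (∀ c, F c ∈ Literature.Geometry.Lorentzian.admissibleVacuumData X) ∧ ∀ c ≠ 0, P (F c)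

/-- item stmt-FinalStateConjecture-26647 · crux · rank 4 · open · by planner
why it might fail: Late-time tails refocusing through an already formed hole's strong field (caustics near photon spheres) could keep forming ever smaller holes at ever later times on a tame-open set; no statement either way is in print (arXiv:2210.13960 p.6).
sources: arXiv:0805.3880, arXiv:1409.6270, Christodoulou1999, arXiv:0811.0354, arXiv:2210.13960, HawkingEllis1973
[crux · child 𝓣₂^∞ of TrappedCaptureExit · thin · conjecturally EMPTY · IDEA-NEEDED; CLEARED by
decomp-fsc-crit-1-g0 2026-08-30T03:23:32Z (k = 3 chosen); writer glue/exactness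
folder/n2bg3/Sketch.lean rc 0 / 0 sorry.] For every Σ and every admissible P_Σ-exceptional datum d
of the capture cell 𝓣₂ (not of dispersive type; every MGHD contains a closed trapped sphere in the
causal future of the data; every MGHD has complete future null infinity; d fails the weak C⁰
property P_w⁰) SOME of whose MGHDs ends with INFINITELY MANY black holes (¬ Finite
(ConnectedComponents ↥𝓑⁺)), there are one end e and a tame (order 1 at e), immersed-at-0, injective
one-parameter family F of admissible data with F 0 = d all of whose members c ≠ 0 satisfy P_Σ. It
isolates the clause «N : ℕ» (finitely many hole charts) of FinalStateDecomposition inside the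
censored trapped basin. Kill path: a quantitative converse of trapped-surface formation (no closed
trapped surface in a region uniformly C¹-close to Minkowski) + late-time decay of the exterior field
⟹ no hole forms after some slab ⟹ finitely many components; classical vacuum has no mass gap
(Christodoulou short pulse arXiv:0805.3880, An–Luk arXiv:1409.627 -/
@[route_item "route-FinalStateConjecture-RootDecompFinalChargeCells", crux]
def InfiniteHoleCaptureExit : Prop :=
  ∀ (X : Type) [TopologicalSpace X] [ChartedSpace Literature.Geometry.Lorentzian.E3 X] [IsManifold (𝓡 3) ((⊤ : ℕ∞) : WithTop ℕ∞) X] [T2Space X] [SecondCountableTopology X] [ConnectedSpace X], let P : Literature.Geometry.Lorentzian.InitialDataSet (𝓡 3) X → Prop := fun D ↦ (∃ 𝒟 : Literature.Geometry.Lorentzian.VacuumCauchyDevelopment D, 𝒟.IsMaximal) ∧ ∀ 𝒟 : Literature.Geometry.Lorentzian.VacuumCauchyDevelopment D, 𝒟.IsMaximal → Summit.FinalStateConjecture.HasCompleteNullInfinity 𝒟.toCauchyDevelopment ∧ ∃ (O : Set 𝒟.carrier) (d : Literature.Geometry.Lorentzian.FinalStateDecomposition 𝒟.toSpacetime O 2),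 (∀ i, Literature.Geometry.Lorentzian.Kerr.IsSubextremal (d.mass i) (d.spin i)) ∧ O = Summit.FinalStateConjecture.exteriorOf 𝒟.toCauchyDevelopment d.charted ∧ Summit.FinalStateConjecture.RaysStayInClosure 𝒟.toCauchyDevelopment O ∧ Summit.FinalStateConjecture.HasExhaustiveCharts d ∧ Summit.FinalStateConjecture.IsFutureOriented d; let Pw0 : Literature.Geometry.Lorentzian.InitialDataSet (𝓡 3) X → Prop := fun D ↦ (∃ 𝒟 : Literature.Geometry.Lorentzian.VacuumCauchyDevelopment D, 𝒟.IsMaximal) ∧ ∀ 𝒟 : Literature.Geometry.Lorentzian.VacuumCauchyDevelopment D, 𝒟.IsMaximal → Summit.FinalStateConjecture.HasCompleteNullInfinity 𝒟.toCauchyDevelopment ∧ ∃ (O : Set 𝒟.carrier) (d : Literature.Geometry.Lorentzian.FinalStateDecomposition 𝒟.toSpacetime O 0), O = Summit.FinalStateConjecture.exteriorOf 𝒟.toCauchyDevelopment d.charted ∧ Summit.FinalStateConjecture.RaysStayInClosure 𝒟.toCauchyDevelopment O ∧ Summit.FinalStateConjecture.HasExhaustiveCharts d ∧ Summit.FinalStateConjecture.IsFutureOriented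 d; let Disp : Literature.Geometry.Lorentzian.InitialDataSet (𝓡 3) X → Prop := fun D ↦ (∃ 𝒟 : Literature.Geometry.Lorentzian.VacuumCauchyDevelopment D, 𝒟.IsMaximal) ∧ ∀ 𝒟 : Literature.Geometry.Lorentzian.VacuumCauchyDevelopment D, 𝒟.IsMaximal → ∀ [𝒟.metric.HasLeviCivita], ¬ 𝒟.metric.IsFutureNullGeodesicallyIncomplete 𝒟.timeOrientation ∧ ¬ 𝒟.metric.IsFutureTimelikeGeodesicallyIncomplete 𝒟.timeOrientation; let Trap : Literature.Geometry.Lorentzian.InitialDataSet (𝓡 3) X → Prop := fun D ↦ (∃ 𝒟 : Literature.Geometry.Lorentzian.VacuumCauchyDevelopment D, 𝒟.IsMaximal) ∧ ∀ 𝒟 : Literature.Geometry.Lorentzian.VacuumCauchyDevelopment D, 𝒟.IsMaximal → ∀ [𝒟.metric.HasLeviCivita], ∃ f : Metric.sphere (0 : Literature.Geometry.Lorentzian.E3) 1 → 𝒟.carrier, Set.range f ⊆ 𝒟.metric.causalFuture 𝒟.timeOrientation (Set.range 𝒟.embed) ∧ 𝒟.metric.IsTrappedSurface (𝓡 2) 𝒟.timeOrientation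 f; let Cens : Literature.Geometry.Lorentzian.InitialDataSet (𝓡 3) X → Prop := fun D ↦ ∀ 𝒟 : Literature.Geometry.Lorentzian.VacuumCauchyDevelopment D, 𝒟.IsMaximal → Summit.FinalStateConjecture.HasCompleteNullInfinity 𝒟.toCauchyDevelopment; let FinMany : Literature.Geometry.Lorentzian.InitialDataSet (𝓡 3) X → Prop := fun D ↦ ∀ 𝒟 : Literature.Geometry.Lorentzian.VacuumCauchyDevelopment D, 𝒟.IsMaximal → ∀ [𝒟.metric.HasLeviCivita], Finite (ConnectedComponents ↥(Literature.Geometry.Lorentzian.DataEmbedding.blackHoleRegion 𝒟.toDataEmbedding ∩ 𝒟.metric.causalFuture 𝒟.timeOrientation (Set.range 𝒟.embed))); ∀ d ∈ Literature.Geometry.Lorentzian.admissibleVacuumData X, ¬ P d → ((¬ Disp d ∧ Trap d ∧ Cens d ∧ ¬ Pw0 d) ∧ ¬ FinMany d) → ∃ (e : Literature.Geometry.Lorentzian.AFEnd X) (F : EuclideanSpace ℝ (Fin 1) → Literature.Geometry.Lorentzian.InitialDataSet (𝓡 3) X), Literature.Geometry.Lorentzian.InitialDataSet.IsTameDataFamily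 e 1 F ∧ Literature.Geometry.Lorentzian.InitialDataSet.IsImmersedAtZero 1 F ∧ F 0 = d ∧ Injective F ∧ (∀ c, F c ∈ Literature.Geometry.Lorentzian.admissibleVacuumData X) ∧ ∀ c ≠ 0, P (F c)

/-- item stmt-FinalStateConjecture-25598 · crux · rank 5 · open · by planner
why it might fail: a tame-open set of admissible vacuum data whose MGHD traps a sphere AND forms a naked singularity outside the resulting black hole (smooth-data analogue of the Hölder-class stability arXiv:2605.16235), or incompleteness of 𝓘⁺ generated by the black-hole region itself on an open set.
sources: doi:10.1088/0264-9381/22/11/019, arXiv:2402.10190, arXiv:2211.15742, arXiv:1912.08478, arXiv:2204.09891, arXiv:1407.4766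
[crux] PIECE 𝓣₁ — TrappedNakedExit [WEAKER·COUNTS·SPECIAL-TYPE — critic CLEARED
2026-08-30T02:40:09Z; weak cosmic censorship AFTER trapping (cell empty in the spherical
scalar-field model doi:10.1088/0264-9381/22/11/019, expected codim ≥ 1 in vacuum); subsumes lens-5's
TrappedNakedCell (critic ruling); leaf IDEA-NEEDED; BARRIER-adjacent nakedSingularityInstability
honoured as the cure]. For every Σ and every admissible P_Σ-exceptional datum d, not of dispersive
type, all of whose MGHDs contain a closed trapped sphere to the future of the data, and SOME of
whose MGHDs has incomplete future null infinity (weak cosmic censorship fails in the presence of a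
trapped sphere), there are one end e and a tame immersed injective one-parameter family F of
admissible data with F 0 = d whose members c ≠ 0 satisfy P_Σ. Model: the cell is EMPTY for
spherically symmetric Einstein–Maxwell–scalar field / Einstein–Vlasov (Dafermos 2005; Rendall 2008
§11.5); in vacuum 3+1 expected inhabited (naked-singularity datum superposed with a distant
collapsing region by localized gluing) with positive codimension. [difficulty: open-problem] -/
@[route_item "route-FinalStateConjecture-RootDecompFinalChargeCells", crux]
def TrappedNakedExit : Prop :=
  ∀ (X : Type) [TopologicalSpace X] [ChartedSpace Literature.Geometry.Lorentzian.E3 X] [IsManifold (𝓡 3) ((⊤ : ℕ∞) : WithTop ℕ∞) X] [T2Space X] [SecondCountableTopology X] [ConnectedSpace X], let P : Literature.Geometry.Lorentzian.InitialDataSet (𝓡 3) X → Prop := fun D ↦ (∃ 𝒟 : Literature.Geometry.Lorentzian.VacuumCauchyDevelopment D, 𝒟.IsMaximal) ∧ ∀ 𝒟 : Literature.Geometry.Lorentzian.VacuumCauchyDevelopment D, 𝒟.IsMaximal → Summit.FinalStateConjecture.HasCompleteNullInfinity 𝒟.toCauchyDevelopment ∧ ∃ (O : Set 𝒟.carrier)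 (d : Literature.Geometry.Lorentzian.FinalStateDecomposition 𝒟.toSpacetime O 2), (∀ i, Literature.Geometry.Lorentzian.Kerr.IsSubextremal (d.mass i) (d.spin i)) ∧ O = Summit.FinalStateConjecture.exteriorOf 𝒟.toCauchyDevelopment d.charted ∧ Summit.FinalStateConjecture.RaysStayInClosure 𝒟.toCauchyDevelopment O ∧ Summit.FinalStateConjecture.HasExhaustiveCharts d ∧ Summit.FinalStateConjecture.IsFutureOriented d; let Disp : Literature.Geometry.Lorentzian.InitialDataSet (𝓡 3) X → Prop := fun D ↦ (∃ 𝒟 : Literature.Geometry.Lorentzian.VacuumCauchyDevelopment D, 𝒟.IsMaximal) ∧ ∀ 𝒟 : Literature.Geometry.Lorentzian.VacuumCauchyDevelopment D, 𝒟.IsMaximal → ∀ [𝒟.metric.HasLeviCivita], ¬ 𝒟.metric.IsFutureNullGeodesicallyIncomplete 𝒟.timeOrientation ∧ ¬ 𝒟.metric.IsFutureTimelikeGeodesicallyIncomplete 𝒟.timeOrientation; let Trap : Literature.Geometry.Lorentzian.InitialDataSet (𝓡 3) X → Prop := fun D ↦ (∃ 𝒟 : Literature.Geometry.Lorentzian.VacuumCauchyDevelopment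 D, 𝒟.IsMaximal) ∧ ∀ 𝒟 : Literature.Geometry.Lorentzian.VacuumCauchyDevelopment D, 𝒟.IsMaximal → ∀ [𝒟.metric.HasLeviCivita], ∃ f : Metric.sphere (0 : Literature.Geometry.Lorentzian.E3) 1 → 𝒟.carrier, Set.range f ⊆ 𝒟.metric.causalFuture 𝒟.timeOrientation (Set.range 𝒟.embed) ∧ 𝒟.metric.IsTrappedSurface (𝓡 2) 𝒟.timeOrientation f; let Cens : Literature.Geometry.Lorentzian.InitialDataSet (𝓡 3) X → Prop := fun D ↦ ∀ 𝒟 : Literature.Geometry.Lorentzian.VacuumCauchyDevelopment D, 𝒟.IsMaximal → Summit.FinalStateConjecture.HasCompleteNullInfinity 𝒟.toCauchyDevelopment; ∀ d ∈ Literature.Geometry.Lorentzian.admissibleVacuumData X, ¬ P d → (¬ Disp d ∧ Trap d ∧ ¬ Cens d) → ∃ (e : Literature.Geometry.Lorentzian.AFEnd X) (F : EuclideanSpace ℝ (Fin 1) → Literature.Geometry.Lorentzian.InitialDataSet (𝓡 3) X), Literature.Geometry.Lorentzian.InitialDataSet.IsTameDataFamily e 1 F ∧ Literature.Geometry.Lorentzian.InitialDataSet.IsImmersedAtZero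 1 F ∧ F 0 = d ∧ Injective F ∧ (∀ c, F c ∈ Literature.Geometry.Lorentzian.admissibleVacuumData X) ∧ ∀ c ≠ 0, P (F c)

/-- item stmt-FinalStateConjecture-25599 · crux · rank 6 · open · by planner
why it might fail: the set of trapped data with exactly extremal remnants could be tame-thick (accumulating on itself along every tame line through a member), or every tame exit from it could pass through uncensored data; vacuum extremal Kerr formation itself is open (arXiv:2402.10190 p.12).
sources: arXiv:2211.15742, arXiv:2402.10190, arXiv:2304.08455, Aretakis2015, arXiv:1402.7034, Israel1986
[crux] PIECE 𝓣₃ — TrappedExtremalExit [WEAKER·COUNTS·SPECIAL-TYPE — critic CLEARED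
2026-08-30T02:40:09Z; generic THIRD LAW after trapping (transversal crossing of |a_f|/M_f = 1 along
a tame line) + pointwise C⁰→C² upgrade at sub-extremal members (content pinned by
stmt-FinalStateConjecture-17298 SubextremalUpgrade, cited by name); MODEL-ANALOGUE in print not a
rung (arXiv:2211.15742 Thm 1); INSTRUMENTABLE (remnant-spin census); BARRIER AretakisInstability
OUTSIDE (asks to leave the cell)]. For every Σ and every admissible P_Σ-exceptional datum d, not of
dispersive type, all of whose MGHDs contain a closed trapped sphere to the future of the data, and
which SATISFIES the weak C⁰ property P_w⁰ (an MGHD exists; every MGHD has complete 𝓘⁺ and an honest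
C⁰ Kerr final-state decomposition with |a_i| ≤ M_i and the Statement's four clauses) — so that,
given the registered pointwise upgrade stmt-17298, d fails P_Σ exactly because one of its MGHDs has
only end states with an exactly extremal hole — there are one end e and a tame immersed injective
one-parameter family F of admissible data with F 0 = d whose members c ≠ 0 satisfy P_Σ. Content: the
generic third law after trapping (final |a_f|/ -/
@[route_item "route-FinalStateConjecture-RootDecompFinalChargeCells", crux]
def TrappedExtremalExit : Prop :=
  ∀ (X : Type) [TopologicalSpace X] [ChartedSpace Literature.Geometry.Lorentzian.E3 X] [IsManifold (𝓡 3) ((⊤ : ℕ∞) : WithTop ℕ∞) X] [T2Space X] [SecondCountableTopology X] [ConnectedSpace X], let P : Literature.Geometry.Lorentzian.InitialDataSet (𝓡 3) X → Prop := fun D ↦ (∃ 𝒟 : Literature.Geometry.Lorentzian.VacuumCauchyDevelopment D, 𝒟.IsMaximal) ∧ ∀ 𝒟 : Literature.Geometry.Lorentzian.VacuumCauchyDevelopment D, 𝒟.IsMaximal → Summit.FinalStateConjecture.HasCompleteNullInfinity 𝒟.toCauchyDevelopment ∧ ∃ (O : Set 𝒟.carrier) (d : Literature.Geometry.Lorentzian.FinalStateDecomposition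 𝒟.toSpacetime O 2), (∀ i, Literature.Geometry.Lorentzian.Kerr.IsSubextremal (d.mass i) (d.spin i)) ∧ O = Summit.FinalStateConjecture.exteriorOf 𝒟.toCauchyDevelopment d.charted ∧ Summit.FinalStateConjecture.RaysStayInClosure 𝒟.toCauchyDevelopment O ∧ Summit.FinalStateConjecture.HasExhaustiveCharts d ∧ Summit.FinalStateConjecture.IsFutureOriented d; let Pw0 : Literature.Geometry.Lorentzian.InitialDataSet (𝓡 3) X → Prop := fun D ↦ (∃ 𝒟 : Literature.Geometry.Lorentzian.VacuumCauchyDevelopment D, 𝒟.IsMaximal) ∧ ∀ 𝒟 : Literature.Geometry.Lorentzian.VacuumCauchyDevelopment D, 𝒟.IsMaximal → Summit.FinalStateConjecture.HasCompleteNullInfinity 𝒟.toCauchyDevelopment ∧ ∃ (O : Set 𝒟.carrier) (d : Literature.Geometry.Lorentzian.FinalStateDecomposition 𝒟.toSpacetime O 0), O = Summit.FinalStateConjecture.exteriorOf 𝒟.toCauchyDevelopment d.charted ∧ Summit.FinalStateConjecture.RaysStayInClosure 𝒟.toCauchyDevelopment O ∧ Summit.FinalStateConjecture.HasExhaustiveCharts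 d ∧ Summit.FinalStateConjecture.IsFutureOriented d; let Disp : Literature.Geometry.Lorentzian.InitialDataSet (𝓡 3) X → Prop := fun D ↦ (∃ 𝒟 : Literature.Geometry.Lorentzian.VacuumCauchyDevelopment D, 𝒟.IsMaximal) ∧ ∀ 𝒟 : Literature.Geometry.Lorentzian.VacuumCauchyDevelopment D, 𝒟.IsMaximal → ∀ [𝒟.metric.HasLeviCivita], ¬ 𝒟.metric.IsFutureNullGeodesicallyIncomplete 𝒟.timeOrientation ∧ ¬ 𝒟.metric.IsFutureTimelikeGeodesicallyIncomplete 𝒟.timeOrientation; let Trap : Literature.Geometry.Lorentzian.InitialDataSet (𝓡 3) X → Prop := fun D ↦ (∃ 𝒟 : Literature.Geometry.Lorentzian.VacuumCauchyDevelopment D, 𝒟.IsMaximal) ∧ ∀ 𝒟 : Literature.Geometry.Lorentzian.VacuumCauchyDevelopment D, 𝒟.IsMaximal → ∀ [𝒟.metric.HasLeviCivita], ∃ f : Metric.sphere (0 : Literature.Geometry.Lorentzian.E3) 1 → 𝒟.carrier, Set.range f ⊆ 𝒟.metric.causalFuture 𝒟.timeOrientation (Set.range 𝒟.embed) ∧ 𝒟.metric.IsTrappedSurface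 (𝓡 2) 𝒟.timeOrientation f; ∀ d ∈ Literature.Geometry.Lorentzian.admissibleVacuumData X, ¬ P d → (¬ Disp d ∧ Trap d ∧ Pw0 d) → ∃ (e : Literature.Geometry.Lorentzian.AFEnd X) (F : EuclideanSpace ℝ (Fin 1) → Literature.Geometry.Lorentzian.InitialDataSet (𝓡 3) X), Literature.Geometry.Lorentzian.InitialDataSet.IsTameDataFamily e 1 F ∧ Literature.Geometry.Lorentzian.InitialDataSet.IsImmersedAtZero 1 F ∧ F 0 = d ∧ Injective F ∧ (∀ c, F c ∈ Literature.Geometry.Lorentzian.admissibleVacuumData X) ∧ ∀ c ≠ 0, P (F c)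

/-- item stmt-FinalStateConjecture-24765 · crux · rank 7 · open · by planner
why it might fail: the extremal critical set B_crit could be thick in the tame topology (extremal thresholds accumulating on themselves along every tame line), or leaving the threshold could land in naked data; vacuum extremal formation itself is open (arXiv:2402.10190 p.12).
sources: arXiv:2402.10190, arXiv:2211.15742, arXiv:2304.08455
[crux] PIECE 𝓝∧P_w — ExtremalThresholdExit [WEAKER·thin — critic CLEARED 2026-08-30T01:39:13Z with
retag: the printed Kehle–Unger exit family (arXiv:2402.10190 Thm 1, Einstein–Maxwell–Vlasov) is a
MODEL-ANALOGUE, not a rung; leaf IDEA-NEEDED; BARRIER placement: AretakisInstability concerns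
settling ON the threshold, this piece only asks to LEAVE it along a tame curve — outside; the bet is
transversality of B_crit]. For every Σ and every admissible P_Σ-exceptional datum d of threshold
type (not dispersive, not trapped) which satisfies the WEAK property P_w (an MGHD exists; every MGHD
has complete 𝓘⁺ and a Kerr final state decomposition with all the Statement's clauses but only |aᵢ|
≤ Mᵢ — so d fails P_Σ only through an exactly extremal final hole), there are one end e and a tame
immersed injective one-parameter family F of admissible data with F 0 = d whose members c ≠ 0
satisfy P_Σ. [difficulty: open-problem] -/
@[route_item "route-FinalStateConjecture-RootDecompFinalChargeCells", crux]
def ExtremalThresholdExit : Prop :=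
  ∀ (X : Type) [TopologicalSpace X] [ChartedSpace Literature.Geometry.Lorentzian.E3 X] [IsManifold (𝓡 3) ((⊤ : ℕ∞) : WithTop ℕ∞) X] [T2Space X] [SecondCountableTopology X] [ConnectedSpace X], let P : Literature.Geometry.Lorentzian.InitialDataSet (𝓡 3) X → Prop := fun D ↦ (∃ 𝒟 : Literature.Geometry.Lorentzian.VacuumCauchyDevelopment D, 𝒟.IsMaximal) ∧ ∀ 𝒟 : Literature.Geometry.Lorentzian.VacuumCauchyDevelopment D, 𝒟.IsMaximal → Summit.FinalStateConjecture.HasCompleteNullInfinity 𝒟.toCauchyDevelopment ∧ ∃ (O : Set 𝒟.carrier) (d : Literature.Geometry.Lorentzian.FinalStateDecomposition 𝒟.toSpacetime O 2), (∀ i, Literature.Geometry.Lorentzian.Kerr.IsSubextremal (d.mass i) (d.spin i)) ∧ O = Summit.FinalStateConjecture.exteriorOf 𝒟.toCauchyDevelopment d.charted ∧ Summit.FinalStateConjecture.RaysStayInClosure 𝒟.toCauchyDevelopment O ∧ Summit.FinalStateConjecture.HasExhaustiveCharts d ∧ Summit.FinalStateConjecture.IsFutureOriented d; let Pw : Literature.Geometry.Lorentzian.InitialDataSet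 (𝓡 3) X → Prop := fun D ↦ (∃ 𝒟 : Literature.Geometry.Lorentzian.VacuumCauchyDevelopment D, 𝒟.IsMaximal) ∧ ∀ 𝒟 : Literature.Geometry.Lorentzian.VacuumCauchyDevelopment D, 𝒟.IsMaximal → Summit.FinalStateConjecture.HasCompleteNullInfinity 𝒟.toCauchyDevelopment ∧ ∃ (O : Set 𝒟.carrier) (d : Literature.Geometry.Lorentzian.FinalStateDecomposition 𝒟.toSpacetime O 2), O = Summit.FinalStateConjecture.exteriorOf 𝒟.toCauchyDevelopment d.charted ∧ Summit.FinalStateConjecture.RaysStayInClosure 𝒟.toCauchyDevelopment O ∧ Summit.FinalStateConjecture.HasExhaustiveCharts d ∧ Summit.FinalStateConjecture.IsFutureOriented d; let Disp : Literature.Geometry.Lorentzian.InitialDataSet (𝓡 3) X → Prop := fun D ↦ (∃ 𝒟 : Literature.Geometry.Lorentzian.VacuumCauchyDevelopment D, 𝒟.IsMaximal) ∧ ∀ 𝒟 : Literature.Geometry.Lorentzian.VacuumCauchyDevelopment D, 𝒟.IsMaximal → ∀ [𝒟.metric.HasLeviCivita], ¬ 𝒟.metric.IsFutureNullGeodesicallyIncomplete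 𝒟.timeOrientation ∧ ¬ 𝒟.metric.IsFutureTimelikeGeodesicallyIncomplete 𝒟.timeOrientation; let Trap : Literature.Geometry.Lorentzian.InitialDataSet (𝓡 3) X → Prop := fun D ↦ (∃ 𝒟 : Literature.Geometry.Lorentzian.VacuumCauchyDevelopment D, 𝒟.IsMaximal) ∧ ∀ 𝒟 : Literature.Geometry.Lorentzian.VacuumCauchyDevelopment D, 𝒟.IsMaximal → ∀ [𝒟.metric.HasLeviCivita], ∃ f : Metric.sphere (0 : Literature.Geometry.Lorentzian.E3) 1 → 𝒟.carrier, Set.range f ⊆ 𝒟.metric.causalFuture 𝒟.timeOrientation (Set.range 𝒟.embed) ∧ 𝒟.metric.IsTrappedSurface (𝓡 2) 𝒟.timeOrientation f; ∀ d ∈ Literature.Geometry.Lorentzian.admissibleVacuumData X, ¬ P d → (¬ Disp d ∧ ¬ Trap d ∧ Pw d) → ∃ (e : Literature.Geometry.Lorentzian.AFEnd X) (F : EuclideanSpace ℝ (Fin 1) → Literature.Geometry.Lorentzian.InitialDataSet (𝓡 3) X), Literature.Geometry.Lorentzian.InitialDataSet.IsTameDataFamily e 1 F ∧ Literature.Geometry.Lorentzian.InitialDataSet.IsImmersedAtZero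 1 F ∧ F 0 = d ∧ Injective F ∧ (∀ c, F c ∈ Literature.Geometry.Lorentzian.admissibleVacuumData X) ∧ ∀ c ≠ 0, P (F c)

/-- item stmt-FinalStateConjecture-27604 · crux · rank 8 · open · by planner
why it might fail: Vacuous iff 13847 FiniteCensus holds on the cell; a single-final-hole development whose future slices carry unboundedly many disjoint shrinking outermost-MOTS bodies (not excluded by Penrose-type area/mass heuristics) would make it contentful and as hard as 26645 there.
sources: HawkingEllis1973, AnderssonMetzgerTrapped2009, arXiv:0805.3880, arXiv:1407.4766, doi:10.1103/PhysRevLett.14.57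
[support · THIN BRIDGE ⟸ stmt-13847 · conjecturally VACUOUS · dominated] lens-5 g4
«FutureCensusCarve» child 2 of SingleHoleCaptureExit (stmt-26645; CLEARED[split]
2026-08-30T04:18:58Z): the cell 𝓒 AND ¬CenFinF d (one final hole, yet some MGHD carries future
Cauchy slices with arbitrarily many pairwise-disjoint outermost-MOTS bodies) — admits a tame
injective exit line with P verbatim. Registered kill path: stmt-13847 CriticalAncestry.FiniteCensus
⟹ this item, kernel-certified by the lens as cascadeSingleExit_of_finiteCensus : FiniteCensusR →
CascadeSingleExit (an unbundled future slice IS a CauchyDevelopment D′ with rfl-same spacetime;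
FiniteCensusR = character-identical copy of 13847 because importing Theses.CriticalAncestry answers
rc 75 unbuilt) — modus ponens, no analysis; closes the day 13847 closes. Kind support = per-route
bookkeeping for a dominated bridge (it never drives staffing). c5 harmless here (13847 carries the
same clause). -/
@[route_item "route-FinalStateConjecture-RootDecompFinalChargeCells", crux]
def CascadeSingleExit : Prop :=
  ∀ (X : Type) [TopologicalSpace X] [ChartedSpace Literature.Geometry.Lorentzian.E3 X] [IsManifold (𝓡 3) ((⊤ : ℕ∞) : WithTop ℕ∞) X] [T2Space X] [SecondCountableTopology X] [ConnectedSpace X], let P : Literature.Geometry.Lorentzian.InitialDataSet (𝓡 3) X → Prop := fun D ↦ (∃ 𝒟 : Literature.Geometry.Lorentzian.VacuumCauchyDevelopment D, 𝒟.IsMaximal) ∧ ∀ 𝒟 : Literature.Geometry.Lorentzian.VacuumCauchyDevelopment D, 𝒟.IsMaximal → Summit.FinalStateConjecture.HasCompleteNullInfinity 𝒟.toCauchyDevelopment ∧ ∃ (O : Set 𝒟.carrier) (d : Literature.Geometry.Lorentzian.FinalStateDecomposition 𝒟.toSpacetime O 2), (∀ i, Literature.Geometry.Lorentzian.Kerr.IsSubextremal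 (d.mass i) (d.spin i)) ∧ O = Summit.FinalStateConjecture.exteriorOf 𝒟.toCauchyDevelopment d.charted ∧ Summit.FinalStateConjecture.RaysStayInClosure 𝒟.toCauchyDevelopment O ∧ Summit.FinalStateConjecture.HasExhaustiveCharts d ∧ Summit.FinalStateConjecture.IsFutureOriented d; let Pw0 : Literature.Geometry.Lorentzian.InitialDataSet (𝓡 3) X → Prop := fun D ↦ (∃ 𝒟 : Literature.Geometry.Lorentzian.VacuumCauchyDevelopment D, 𝒟.IsMaximal) ∧ ∀ 𝒟 : Literature.Geometry.Lorentzian.VacuumCauchyDevelopment D, 𝒟.IsMaximal → Summit.FinalStateConjecture.HasCompleteNullInfinity 𝒟.toCauchyDevelopment ∧ ∃ (O : Set 𝒟.carrier) (d : Literature.Geometry.Lorentzian.FinalStateDecomposition 𝒟.toSpacetime O 0), O = Summit.FinalStateConjecture.exteriorOf 𝒟.toCauchyDevelopment d.charted ∧ Summit.FinalStateConjecture.RaysStayInClosure 𝒟.toCauchyDevelopment O ∧ Summit.FinalStateConjecture.HasExhaustiveCharts d ∧ Summit.FinalStateConjecture.IsFutureOriented d; let Disp : Literature.Geometry.Lorentzian.InitialDataSet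 (𝓡 3) X → Prop := fun D ↦ (∃ 𝒟 : Literature.Geometry.Lorentzian.VacuumCauchyDevelopment D, 𝒟.IsMaximal) ∧ ∀ 𝒟 : Literature.Geometry.Lorentzian.VacuumCauchyDevelopment D, 𝒟.IsMaximal → ∀ [𝒟.metric.HasLeviCivita], ¬ 𝒟.metric.IsFutureNullGeodesicallyIncomplete 𝒟.timeOrientation ∧ ¬ 𝒟.metric.IsFutureTimelikeGeodesicallyIncomplete 𝒟.timeOrientation; let Trap : Literature.Geometry.Lorentzian.InitialDataSet (𝓡 3) X → Prop := fun D ↦ (∃ 𝒟 : Literature.Geometry.Lorentzian.VacuumCauchyDevelopment D, 𝒟.IsMaximal) ∧ ∀ 𝒟 : Literature.Geometry.Lorentzian.VacuumCauchyDevelopment D, 𝒟.IsMaximal → ∀ [𝒟.metric.HasLeviCivita], ∃ f : Metric.sphere (0 : Literature.Geometry.Lorentzian.E3) 1 → 𝒟.carrier, Set.range f ⊆ 𝒟.metric.causalFuture 𝒟.timeOrientation (Set.range 𝒟.embed) ∧ 𝒟.metric.IsTrappedSurface (𝓡 2) 𝒟.timeOrientation f; let Cens : Literature.Geometry.Lorentzian.InitialDataSet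 (𝓡 3) X → Prop := fun D ↦ ∀ 𝒟 : Literature.Geometry.Lorentzian.VacuumCauchyDevelopment D, 𝒟.IsMaximal → Summit.FinalStateConjecture.HasCompleteNullInfinity 𝒟.toCauchyDevelopment; let Single : Literature.Geometry.Lorentzian.InitialDataSet (𝓡 3) X → Prop := fun D ↦ ∀ 𝒟 : Literature.Geometry.Lorentzian.VacuumCauchyDevelopment D, 𝒟.IsMaximal → ∀ [𝒟.metric.HasLeviCivita], Subsingleton (ConnectedComponents ↥(Literature.Geometry.Lorentzian.DataEmbedding.blackHoleRegion 𝒟.toDataEmbedding ∩ 𝒟.metric.causalFuture 𝒟.timeOrientation (Set.range 𝒟.embed))); let CenFinF : Literature.Geometry.Lorentzian.InitialDataSet (𝓡 3) X → Prop := fun D ↦ ∀ 𝒟 : Literature.Geometry.Lorentzian.VacuumCauchyDevelopment D, 𝒟.IsMaximal → ∃ n : ℕ, ∀ (X' : Type) [TopologicalSpace X'] [ChartedSpace Literature.Geometry.Lorentzian.E3 X'] [IsManifold (𝓡 3) ((⊤ : ℕ∞) : WithTop ℕ∞) X'] [ConnectedSpace X'] (D' : Literature.Geometry.Lorentzian.InitialDataSet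 (𝓡 3) X') (ι' : X' → 𝒟.carrier) (ν' : Literature.Geometry.Lorentzian.NormalField (𝓡 4) ι'), Manifold.IsSmoothEmbedding (𝓡 3) (𝓡 4) ((⊤ : ℕ∞) : WithTop ℕ∞) ι' → 𝒟.metric.IsFutureUnitNormal (𝓡 3) 𝒟.timeOrientation ι' ν' → (∀ y : X', Literature.Geometry.Lorentzian.pullbackBilin (I := 𝓡 4) (I' := 𝓡 3) ι' 𝒟.metric.val y = D'.h.inner y) → (∀ [𝒟.metric.toPseudoRiemannianMetric.HasLeviCivita] (y : X'), 𝒟.metric.toPseudoRiemannianMetric.secondFundamentalForm (𝓡 3) ι' ν' y = D'.kBilin y) → 𝒟.metric.IsCauchyHypersurface 𝒟.timeOrientation (Set.range ι') → Set.range ι' ⊆ 𝒟.metric.causalFuture 𝒟.timeOrientation (Set.range 𝒟.embed) → ∀ S : Fin (n + 1) → Literature.Geometry.Lorentzian.OutermostMOTS (𝓡 3) D'.h D'.k, (∀ j, ConnectedSpace (S j).surf) → (∀ j, IsCompact (((S j).exterior : Set X'))ᶜ ∧ (interior (((S j).exterior : Set X'))ᶜ).Nonempty) → ∃ j j', j ≠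 j' ∧ ((((S j).exterior : Set X'))ᶜ ∩ (((S j').exterior : Set X'))ᶜ).Nonempty; ∀ d ∈ Literature.Geometry.Lorentzian.admissibleVacuumData X, ¬ P d → (((¬ Disp d ∧ Trap d ∧ Cens d ∧ ¬ Pw0 d) ∧ Single d) ∧ ¬ CenFinF d) → ∃ (e : Literature.Geometry.Lorentzian.AFEnd X) (F : EuclideanSpace ℝ (Fin 1) → Literature.Geometry.Lorentzian.InitialDataSet (𝓡 3) X), Literature.Geometry.Lorentzian.InitialDataSet.IsTameDataFamily e 1 F ∧ Literature.Geometry.Lorentzian.InitialDataSet.IsImmersedAtZero 1 F ∧ F 0 = d ∧ Injective F ∧ (∀ c, F c ∈ Literature.Geometry.Lorentzian.admissibleVacuumData X) ∧ ∀ c ≠ 0, P (F c)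

/-- item stmt-FinalStateConjecture-24766 · support · rank 9 · open · by planner
why it might fail: a non-radiating vacuum breather or a complete development with curvature not decaying at i⁺ whose tame neighbours are also exceptional (an open set) refutes it; no-breather results hold only near 𝓘 (arXiv:1504.04592) or for decaying solutions (arXiv:2108.13379).
sources: arXiv:2108.13379, arXiv:1504.04592, doi:10.1007/PL00001021
[crux] PIECE 𝓒 — DispersiveExit [WEAKER·thin — critic CLEARED 2026-08-30T01:39:13Z; implied outright
by the registered pointwise item stmt-FinalStateConjecture-17320
`NoParkingWithoutHorizon.CompleteSpacetimesDisperse` (lens kernel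
`dispersiveExit_of_completeSpacetimesDisperse`; cited by name, not re-typed); leaf IDEA-NEEDED;
attackable-now sub-rung: stationary-complete ⇒ flat (Lichnerowicz–Anderson port); rung stmt-10029
NoVacuumBreathers]. For every Σ and every admissible P_Σ-exceptional datum d of dispersive type (an
MGHD exists and every MGHD is future causally geodesically complete: no future null or timelike
geodesic incompleteness, stated under the metric's Levi-Civita instance), there are one end e and a
tame immersed injective one-parameter family F of admissible data with F 0 = d whose members c ≠ 0
satisfy P_Σ. [difficulty: open-problem] -/
@[route_item "route-FinalStateConjecture-RootDecompFinalChargeCells", crux]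
def DispersiveExit : Prop :=
  ∀ (X : Type) [TopologicalSpace X] [ChartedSpace Literature.Geometry.Lorentzian.E3 X] [IsManifold (𝓡 3) ((⊤ : ℕ∞) : WithTop ℕ∞) X] [T2Space X] [SecondCountableTopology X] [ConnectedSpace X], let P : Literature.Geometry.Lorentzian.InitialDataSet (𝓡 3) X → Prop := fun D ↦ (∃ 𝒟 : Literature.Geometry.Lorentzian.VacuumCauchyDevelopment D, 𝒟.IsMaximal) ∧ ∀ 𝒟 : Literature.Geometry.Lorentzian.VacuumCauchyDevelopment D, 𝒟.IsMaximal → Summit.FinalStateConjecture.HasCompleteNullInfinity 𝒟.toCauchyDevelopment ∧ ∃ (O : Set 𝒟.carrier) (d : Literature.Geometry.Lorentzian.FinalStateDecomposition 𝒟.toSpacetime O 2), (∀ i, Literature.Geometry.Lorentzian.Kerr.IsSubextremal (d.mass i) (d.spin i)) ∧ O = Summit.FinalStateConjecture.exteriorOf 𝒟.toCauchyDevelopment d.charted ∧ Summit.FinalStateConjecture.RaysStayInClosure 𝒟.toCauchyDevelopment O ∧ Summit.FinalStateConjecture.HasExhaustiveCharts d ∧ Summit.FinalStateConjecture.IsFutureOriented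 d; let Disp : Literature.Geometry.Lorentzian.InitialDataSet (𝓡 3) X → Prop := fun D ↦ (∃ 𝒟 : Literature.Geometry.Lorentzian.VacuumCauchyDevelopment D, 𝒟.IsMaximal) ∧ ∀ 𝒟 : Literature.Geometry.Lorentzian.VacuumCauchyDevelopment D, 𝒟.IsMaximal → ∀ [𝒟.metric.HasLeviCivita], ¬ 𝒟.metric.IsFutureNullGeodesicallyIncomplete 𝒟.timeOrientation ∧ ¬ 𝒟.metric.IsFutureTimelikeGeodesicallyIncomplete 𝒟.timeOrientation; ∀ d ∈ Literature.Geometry.Lorentzian.admissibleVacuumData X, ¬ P d → Disp d → ∃ (e : Literature.Geometry.Lorentzian.AFEnd X) (F : EuclideanSpace ℝ (Fin 1) → Literature.Geometry.Lorentzian.InitialDataSet (𝓡 3) X), Literature.Geometry.Lorentzian.InitialDataSet.IsTameDataFamily e 1 F ∧ Literature.Geometry.Lorentzian.InitialDataSet.IsImmersedAtZero 1 F ∧ F 0 = d ∧ Injective F ∧ (∀ c, F c ∈ Literature.Geometry.Lorentzian.admissibleVacuumData X) ∧ ∀ c ≠ 0, P (F c)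

/-- item stmt-FinalStateConjecture-24767 · support · rank 9 · open · by planner
why it might fail: a smooth-data analogue of the Singh–Zheng stability — a tame-open set of admissible vacuum data forming naked singularities (RSR arXiv:1912.08478 exteriors are fine-tuned, consistent so far).
sources: Christodoulou1999, arXiv:1912.08478, arXiv:2204.09891, arXiv:2605.16235, arXiv:0811.0354
[crux] PIECE 𝓝∧¬P_w — NakedThresholdExit [WEAKER·COUNTS — critic CLEARED 2026-08-30T01:39:13Z; =
weak cosmic censorship on the untrapped incomplete sector in Christodoulou's own codimension form
(the all-cells version is the registered hard core stmt-FinalStateConjecture-17269, cited; this is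
its cell restriction with cure target P_Σ); leaf IDEA-NEEDED; BARRIER: nakedSingularityInstability
is the MODEL exit family (Christodoulou1999 Thm 4.1, 2-plane of exits) = the generic form, outside
the genericity-blind class; functional-framework dependence (Singh–Zheng arXiv:2605.16235:
Hölder-stable naked singularities in the spherical scalar field) — the bet is that smooth tame data
are on the unstable side]. For every Σ and every admissible P_Σ-exceptional datum d of threshold
type (not dispersive, not trapped) failing even the weak property P_w (no MGHD, or an MGHD with
incomplete 𝓘⁺, or censored but settling to no Kerr configuration with |aᵢ| ≤ Mᵢ), there are one end
e and a tame immersed injective one-parameter family F of admissible data with F 0 = d whose members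
c ≠ 0 satisfy P_Σ. [difficulty: open-problem] -/
@[route_item "route-FinalStateConjecture-RootDecompFinalChargeCells", crux]
def NakedThresholdExit : Prop :=
  ∀ (X : Type) [TopologicalSpace X] [ChartedSpace Literature.Geometry.Lorentzian.E3 X] [IsManifold (𝓡 3) ((⊤ : ℕ∞) : WithTop ℕ∞) X] [T2Space X] [SecondCountableTopology X] [ConnectedSpace X], let P : Literature.Geometry.Lorentzian.InitialDataSet (𝓡 3) X → Prop := fun D ↦ (∃ 𝒟 : Literature.Geometry.Lorentzian.VacuumCauchyDevelopment D, 𝒟.IsMaximal) ∧ ∀ 𝒟 : Literature.Geometry.Lorentzian.VacuumCauchyDevelopment D, 𝒟.IsMaximal → Summit.FinalStateConjecture.HasCompleteNullInfinity 𝒟.toCauchyDevelopment ∧ ∃ (O : Set 𝒟.carrier) (d : Literature.Geometry.Lorentzian.FinalStateDecomposition 𝒟.toSpacetime O 2), (∀ i, Literature.Geometry.Lorentzian.Kerr.IsSubextremal (d.mass i) (d.spin i)) ∧ O = Summit.FinalStateConjecture.exteriorOf 𝒟.toCauchyDevelopment d.charted ∧ Summit.FinalStateConjecture.RaysStayInClosure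 𝒟.toCauchyDevelopment O ∧ Summit.FinalStateConjecture.HasExhaustiveCharts d ∧ Summit.FinalStateConjecture.IsFutureOriented d; let Pw : Literature.Geometry.Lorentzian.InitialDataSet (𝓡 3) X → Prop := fun D ↦ (∃ 𝒟 : Literature.Geometry.Lorentzian.VacuumCauchyDevelopment D, 𝒟.IsMaximal) ∧ ∀ 𝒟 : Literature.Geometry.Lorentzian.VacuumCauchyDevelopment D, 𝒟.IsMaximal → Summit.FinalStateConjecture.HasCompleteNullInfinity 𝒟.toCauchyDevelopment ∧ ∃ (O : Set 𝒟.carrier) (d : Literature.Geometry.Lorentzian.FinalStateDecomposition 𝒟.toSpacetime O 2), O = Summit.FinalStateConjecture.exteriorOf 𝒟.toCauchyDevelopment d.charted ∧ Summit.FinalStateConjecture.RaysStayInClosure 𝒟.toCauchyDevelopment O ∧ Summit.FinalStateConjecture.HasExhaustiveCharts d ∧ Summit.FinalStateConjecture.IsFutureOriented d; let Disp : Literature.Geometry.Lorentzian.InitialDataSet (𝓡 3) X → Prop := fun D ↦ (∃ 𝒟 : Literature.Geometry.Lorentzian.VacuumCauchyDevelopment D, 𝒟.IsMaximal) ∧ ∀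 𝒟 : Literature.Geometry.Lorentzian.VacuumCauchyDevelopment D, 𝒟.IsMaximal → ∀ [𝒟.metric.HasLeviCivita], ¬ 𝒟.metric.IsFutureNullGeodesicallyIncomplete 𝒟.timeOrientation ∧ ¬ 𝒟.metric.IsFutureTimelikeGeodesicallyIncomplete 𝒟.timeOrientation; let Trap : Literature.Geometry.Lorentzian.InitialDataSet (𝓡 3) X → Prop := fun D ↦ (∃ 𝒟 : Literature.Geometry.Lorentzian.VacuumCauchyDevelopment D, 𝒟.IsMaximal) ∧ ∀ 𝒟 : Literature.Geometry.Lorentzian.VacuumCauchyDevelopment D, 𝒟.IsMaximal → ∀ [𝒟.metric.HasLeviCivita], ∃ f : Metric.sphere (0 : Literature.Geometry.Lorentzian.E3) 1 → 𝒟.carrier, Set.range f ⊆ 𝒟.metric.causalFuture 𝒟.timeOrientation (Set.range 𝒟.embed) ∧ 𝒟.metric.IsTrappedSurface (𝓡 2) 𝒟.timeOrientation f; ∀ d ∈ Literature.Geometry.Lorentzian.admissibleVacuumData X, ¬ P d → (¬ Disp d ∧ ¬ Trap d ∧ ¬ Pw d) → ∃ (e : Literature.Geometry.Lorentzian.AFEnd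 X) (F : EuclideanSpace ℝ (Fin 1) → Literature.Geometry.Lorentzian.InitialDataSet (𝓡 3) X), Literature.Geometry.Lorentzian.InitialDataSet.IsTameDataFamily e 1 F ∧ Literature.Geometry.Lorentzian.InitialDataSet.IsImmersedAtZero 1 F ∧ F 0 = d ∧ Injective F ∧ (∀ c, F c ∈ Literature.Geometry.Lorentzian.admissibleVacuumData X) ∧ ∀ c ≠ 0, P (F c)

/-- item stmt-FinalStateConjecture-28410 · assembly · rank 1 · open · by planner
sources: doi:10.1111/j.1749-6632.1973.tb41447.x
[assembly] BoundedSingleExit → CascadeSingleExit → MultiHoleCaptureExit → InfiniteHoleCaptureExit →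
TrappedNakedExit → TrappedExtremalExit → ExtremalThresholdExit → DispersiveExit → NakedThresholdExit
→ the final state conjecture as typed. -/
@[route_item "route-FinalStateConjecture-RootDecompFinalChargeCells"]
def Assembly : Prop :=
  BoundedSingleExit → CascadeSingleExit → MultiHoleCaptureExit → InfiniteHoleCaptureExit → TrappedNakedExit → TrappedExtremalExit → ExtremalThresholdExit → DispersiveExit → NakedThresholdExit → FinalStateConjecture

/-! D-0027 §2.1 — DECIDING THEOREM (planner-authored via `route open/edit --closes-file`; by planner-decomp-fsc-writer-1-g0-0 2026-08-30T05:18:56Z):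
its hypotheses are this route's items and its conclusion the sub-problem Statement (glue_lint), and it elaborates with this file. -/

@[closes "route-FinalStateConjecture-RootDecompFinalChargeCells"] theorem closes (hB : BoundedSingleExit) (hCas : CascadeSingleExit) (hMulti : MultiHoleCaptureExit) (hInf : InfiniteHoleCaptureExit) (t₁ : TrappedNakedExit) (t₃ : TrappedExtremalExit) (h₃ : ExtremalThresholdExit) (h₁ : DispersiveExit) (h₄ : NakedThresholdExit) : _root_.FinalStateConjecture := by
  have t₂ : ∀ (X : Type) [TopologicalSpace X] [ChartedSpace Literature.Geometry.Lorentzian.E3 X] [IsManifold (𝓡 3) ((⊤ : ℕ∞) : WithTop ℕ∞) X] [T2Space X] [SecondCountableTopology X] [ConnectedSpace X], let P : Literature.Geometry.Lorentzian.InitialDataSet (𝓡 3) X → Prop := fun D ↦ (∃ 𝒟 : Literature.Geometry.Lorentzian.VacuumCauchyDevelopment D, 𝒟.IsMaximal) ∧ ∀ 𝒟 : Literature.Geometry.Lorentzian.VacuumCauchyDevelopment D, 𝒟.IsMaximal → Summit.FinalStateConjecture.HasCompleteNullInfinity 𝒟.toCauchyDevelopment ∧ ∃ (O : Set 𝒟.carrier)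 (d : Literature.Geometry.Lorentzian.FinalStateDecomposition 𝒟.toSpacetime O 2), (∀ i, Literature.Geometry.Lorentzian.Kerr.IsSubextremal (d.mass i) (d.spin i)) ∧ O = Summit.FinalStateConjecture.exteriorOf 𝒟.toCauchyDevelopment d.charted ∧ Summit.FinalStateConjecture.RaysStayInClosure 𝒟.toCauchyDevelopment O ∧ Summit.FinalStateConjecture.HasExhaustiveCharts d ∧ Summit.FinalStateConjecture.IsFutureOriented d; let Pw0 : Literature.Geometry.Lorentzian.InitialDataSet (𝓡 3) X → Prop := fun D ↦ (∃ 𝒟 : Literature.Geometry.Lorentzian.VacuumCauchyDevelopment D, 𝒟.IsMaximal) ∧ ∀ 𝒟 : Literature.Geometry.Lorentzian.VacuumCauchyDevelopment D, 𝒟.IsMaximal → Summit.FinalStateConjecture.HasCompleteNullInfinity 𝒟.toCauchyDevelopment ∧ ∃ (O : Set 𝒟.carrier) (d : Literature.Geometry.Lorentzian.FinalStateDecomposition 𝒟.toSpacetime O 0), O = Summit.FinalStateConjecture.exteriorOf 𝒟.toCauchyDevelopment d.charted ∧ Summit.FinalStateConjecture.RaysStayInClosure 𝒟.toCauchyDevelopment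 O ∧ Summit.FinalStateConjecture.HasExhaustiveCharts d ∧ Summit.FinalStateConjecture.IsFutureOriented d; let Disp : Literature.Geometry.Lorentzian.InitialDataSet (𝓡 3) X → Prop := fun D ↦ (∃ 𝒟 : Literature.Geometry.Lorentzian.VacuumCauchyDevelopment D, 𝒟.IsMaximal) ∧ ∀ 𝒟 : Literature.Geometry.Lorentzian.VacuumCauchyDevelopment D, 𝒟.IsMaximal → ∀ [𝒟.metric.HasLeviCivita], ¬ 𝒟.metric.IsFutureNullGeodesicallyIncomplete 𝒟.timeOrientation ∧ ¬ 𝒟.metric.IsFutureTimelikeGeodesicallyIncomplete 𝒟.timeOrientation; let Trap : Literature.Geometry.Lorentzian.InitialDataSet (𝓡 3) X → Prop := fun D ↦ (∃ 𝒟 : Literature.Geometry.Lorentzian.VacuumCauchyDevelopment D, 𝒟.IsMaximal) ∧ ∀ 𝒟 : Literature.Geometry.Lorentzian.VacuumCauchyDevelopment D, 𝒟.IsMaximal → ∀ [𝒟.metric.HasLeviCivita], ∃ f : Metric.sphere (0 : Literature.Geometry.Lorentzian.E3) 1 → 𝒟.carrier, Set.range f ⊆ 𝒟.metric.causalFuture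 𝒟.timeOrientation (Set.range 𝒟.embed) ∧ 𝒟.metric.IsTrappedSurface (𝓡 2) 𝒟.timeOrientation f; let Cens : Literature.Geometry.Lorentzian.InitialDataSet (𝓡 3) X → Prop := fun D ↦ ∀ 𝒟 : Literature.Geometry.Lorentzian.VacuumCauchyDevelopment D, 𝒟.IsMaximal → Summit.FinalStateConjecture.HasCompleteNullInfinity 𝒟.toCauchyDevelopment; ∀ d ∈ Literature.Geometry.Lorentzian.admissibleVacuumData X, ¬ P d → (¬ Disp d ∧ Trap d ∧ Cens d ∧ ¬ Pw0 d) → ∃ (e : Literature.Geometry.Lorentzian.AFEnd X) (F : EuclideanSpace ℝ (Fin 1) → Literature.Geometry.Lorentzian.InitialDataSet (𝓡 3) X), Literature.Geometry.Lorentzian.InitialDataSet.IsTameDataFamily e 1 F ∧ Literature.Geometry.Lorentzian.InitialDataSet.IsImmersedAtZero 1 F ∧ F 0 = d ∧ Injective F ∧ (∀ c, F c ∈ Literature.Geometry.Lorentzian.admissibleVacuumData X) ∧ ∀ c ≠ 0, P (F c) := by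
    intro X _ _ _ _ _ _ P Pw0 Disp Trap Cens d hd hP hcell
    exact (Classical.em _).elim (fun hS ↦ (Classical.em _).elim (fun hfin ↦ hB X d hd hP ⟨⟨hcell, hS⟩, hfin⟩) (fun hfin ↦ hCas X d hd hP ⟨⟨hcell, hS⟩, hfin⟩))
      (fun hS ↦ (Classical.em _).elim (fun hF ↦ hMulti X d hd hP ⟨hcell, hS, hF⟩) (fun hF ↦ hInf X d hd hP ⟨hcell, hF⟩))
  intro X _ _ _ _ _ _ d hd
  suffices h : ∃ (e : Literature.Geometry.Lorentzian.AFEnd X) (F : EuclideanSpace ℝ (Fin 1) → Literature.Geometry.Lorentzian.InitialDataSet (𝓡 3) X), Literature.Geometry.Lorentzian.InitialDataSet.IsTameDataFamily e 1 F ∧ Literature.Geometry.Lorentzian.InitialDataSet.IsImmersedAtZero 1 F ∧ F 0 = d ∧ Injective F ∧ (∀ c, F c ∈ Literature.Geometry.Lorentzian.admissibleVacuumData X) ∧ ∀ c ≠ 0, ((∃ 𝒟 : Literature.Geometry.Lorentzian.VacuumCauchyDevelopment (F c), 𝒟.IsMaximal) ∧ ∀ 𝒟 : Literature.Geometry.Lorentzian.VacuumCauchyDevelopment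 (F c), 𝒟.IsMaximal → Summit.FinalStateConjecture.HasCompleteNullInfinity 𝒟.toCauchyDevelopment ∧ ∃ (O : Set 𝒟.carrier) (d : Literature.Geometry.Lorentzian.FinalStateDecomposition 𝒟.toSpacetime O 2), (∀ i, Literature.Geometry.Lorentzian.Kerr.IsSubextremal (d.mass i) (d.spin i)) ∧ O = Summit.FinalStateConjecture.exteriorOf 𝒟.toCauchyDevelopment d.charted ∧ Summit.FinalStateConjecture.RaysStayInClosure 𝒟.toCauchyDevelopment O ∧ Summit.FinalStateConjecture.HasExhaustiveCharts d ∧ Summit.FinalStateConjecture.IsFutureOriented d) by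
    obtain ⟨e, F, h1, h2, h3, h4, h5, h6⟩ := h
    exact ⟨e, F, h1, h2, h3, h4, h5, fun c hc hmem ↦ hmem.2 (h6 c hc)⟩
  by_cases hD : (∃ 𝒟 : Literature.Geometry.Lorentzian.VacuumCauchyDevelopment d, 𝒟.IsMaximal) ∧ ∀ 𝒟 : Literature.Geometry.Lorentzian.VacuumCauchyDevelopment d, 𝒟.IsMaximal → ∀ [𝒟.metric.HasLeviCivita], ¬ 𝒟.metric.IsFutureNullGeodesicallyIncomplete 𝒟.timeOrientation ∧ ¬ 𝒟.metric.IsFutureTimelikeGeodesicallyIncomplete 𝒟.timeOrientation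
  · exact h₁ X d hd.1 hd.2 hD
  by_cases hT : (∃ 𝒟 : Literature.Geometry.Lorentzian.VacuumCauchyDevelopment d, 𝒟.IsMaximal) ∧ ∀ 𝒟 : Literature.Geometry.Lorentzian.VacuumCauchyDevelopment d, 𝒟.IsMaximal → ∀ [𝒟.metric.HasLeviCivita], ∃ f : Metric.sphere (0 : Literature.Geometry.Lorentzian.E3) 1 → 𝒟.carrier, Set.range f ⊆ 𝒟.metric.causalFuture 𝒟.timeOrientation (Set.range 𝒟.embed) ∧ 𝒟.metric.IsTrappedSurface (𝓡 2) 𝒟.timeOrientation f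
  · by_cases hW0 : (fun D ↦ (∃ 𝒟 : Literature.Geometry.Lorentzian.VacuumCauchyDevelopment D, 𝒟.IsMaximal) ∧ ∀ 𝒟 : Literature.Geometry.Lorentzian.VacuumCauchyDevelopment D, 𝒟.IsMaximal → Summit.FinalStateConjecture.HasCompleteNullInfinity 𝒟.toCauchyDevelopment ∧ ∃ (O : Set 𝒟.carrier) (d : Literature.Geometry.Lorentzian.FinalStateDecomposition 𝒟.toSpacetime O 0), O = Summit.FinalStateConjecture.exteriorOf 𝒟.toCauchyDevelopment d.charted ∧ Summit.FinalStateConjecture.RaysStayInClosure 𝒟.toCauchyDevelopment O ∧ Summit.FinalStateConjecture.HasExhaustiveCharts d ∧ Summit.FinalStateConjecture.IsFutureOriented d) d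
    · exact t₃ X d hd.1 hd.2 ⟨hD, hT, hW0⟩
    by_cases hC : (fun D ↦ ∀ 𝒟 : Literature.Geometry.Lorentzian.VacuumCauchyDevelopment D, 𝒟.IsMaximal → Summit.FinalStateConjecture.HasCompleteNullInfinity 𝒟.toCauchyDevelopment) d
    · exact t₂ X d hd.1 hd.2 ⟨hD, hT, hC, hW0⟩
    · exact t₁ X d hd.1 hd.2 ⟨hD, hT, hC⟩
  by_cases hW : (∃ 𝒟 : Literature.Geometry.Lorentzian.VacuumCauchyDevelopment d, 𝒟.IsMaximal) ∧ ∀ 𝒟 : Literature.Geometry.Lorentzian.VacuumCauchyDevelopment d, 𝒟.IsMaximal → Summit.FinalStateConjecture.HasCompleteNullInfinity 𝒟.toCauchyDevelopment ∧ ∃ (O : Set 𝒟.carrier) (d : Literature.Geometry.Lorentzian.FinalStateDecomposition 𝒟.toSpacetime O 2), O = Summit.FinalStateConjecture.exteriorOf 𝒟.toCauchyDevelopment d.charted ∧ Summit.FinalStateConjecture.RaysStayInClosure 𝒟.toCauchyDevelopment O ∧ Summit.FinalStateConjecture.HasExhaustiveCharts d ∧ Summit.FinalStateConjecture.IsFutureOriented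 d
  · exact h₃ X d hd.1 hd.2 ⟨hD, hT, hW⟩
  · exact h₄ X d hd.1 hd.2 ⟨hD, hT, hW⟩

end Summit.FinalStateConjecture.FinalStateConjecture.Theses.RootDecompFinalChargeCells
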